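import Mathlib
import Summits.NavierStokesRegularity.NavierStokesRegularity.Theses.TypeIQuarterGate
import Literature.Analysis.FluidPDE.SelfSimilar
import Literature.Analysis.FluidPDE.AxisymmetricEuler
import Literature.Analysis.FluidPDE.EulerTimeScaling
import Literature.Analysis.FluidPDE.PineauVicolAngularMean
import Literature.Analysis.FluidPDE.PineauVicolRDSSTuning
import Literature.Analysis.FluidPDE.PineauVicolRSS
import Literature.Analysis.FluidPDE.PineauVicolRSSHolds
import Literature.Analysis.FluidPDE.PineauVicolRDSSCompactness
import Literature.Analysis.FluidPDE.PineauVicolRDSSLeray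
import Literature.Analysis.FluidPDE.ClassicalSolutionGlue
import Literature.Analysis.FluidPDE.IsometryInvariance
import Literature.Analysis.FluidPDE.ClassicalSolutionRescale
import Literature.Analysis.FluidPDE.PineauVicolRDSSLiouvilleHolds
import Literature.Analysis.FluidPDE.ChaeWolfRemovingDSSLimit
import Literature.Analysis.FluidPDE.ChaeWolfRemovingDSSProofs
import Literature.Analysis.FluidPDE.PineauVicolRSSChaeWolf
import Literature.Analysis.FluidPDE.NSBoundedMildOseenClassical
import Literature.Analysis.FluidPDE.PressureReconstruction
import Literature.Analysis.FluidPDE.KNSSMildRegularity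
import Literature.Barriers.NavierStokesRegularity.NearOneDssTypeIExclusion
import Summits.NavierStokesRegularity.NavierStokesRegularity.Theorems.TypeIQuarterGateScarEnvelopeTypeISpiralClosureMonoidDichotomy
import Summits.NavierStokesRegularity.NavierStokesRegularity.Theorems.TypeIQuarterGateScarEnvelopeTypeISpiralClosureSymSetAngles
import Summits.NavierStokesRegularity.NavierStokesRegularity.Theorems.TypeICertificateLadderTargetRssCompactness
import Summits.NavierStokesRegularity.NavierStokesRegularity.Theorems.TypeICertificateLadderTargetRdssLiouvilleNear

/-!
**STATUS AFTER BC4 SELF-DISCLOSURE no. 3 (v10, 2026-08-28 13:2xZ) — KNOWN IN TREE, ALTERNATIVE PROOF ONLY.**  The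
ALL-SPEEDS lever of this line is already a landed theorem of route CorkscrewDynamo (crux `CorkscrewProfile`,
stmt-NavierStokesRegularity-11282, lead c4, tool stubs F3–F5): `Theorems.CorkscrewProfile.Birth.exists_rss_of_nearIdentity`
(`Theorems/CorkscrewDynamoCorkscrewProfileNearIdentityRigidity.lean`; nontrivial Oseen-gauge Type-I (`C₀`) fields,
rotated `c_n`-DSS about `e₃` through ANY angles `θ_n`, `c_n ↓ 1` ⇒ a NONTRIVIAL Type-I (same `C₀`) limit `W` which is
ROTATED SELF-SIMILAR, `IsRotatedDSS μ (rotZLIE (β log μ)) W` for every `μ > 0`, with `β ≠ 0` — the `β = 0` branch is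
killed UNCONDITIONALLY by Chae–Wolf; angle tuning for arbitrary angles = `…CorkscrewProfileAngleTuning`
(Dirichlet re-tuning + rate trichotomy), compactness along tuned exponents = `…CorkscrewProfileRdssTunedCompactness`)
and its contrapositive `nearIdentity_rdss_removal_of_not_rssProfileExists` («if there is no RSS profile, Chae–Wolf's
near-identity removal holds for ALL rotated DSS about e₃» = this file's `uniformNearOneRdss_of_rss`, in the
ancient-mild class).  Together with disclosures no. 1 (S6 + topology = `Theorems.rssCompact_*`) and no. 2
(speed-by-speed = `Theorems.rdssCompact_liouville_near`) NOTHING below is new in content.  What this file still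
offers: (a) an ALTERNATIVE PROOF ROUTE of `exists_rss_of_nearIdentity` in Pineau–Vicol's classical class — angle
extraction mod 2π on a countable scale set + the closed symmetry MONOID and its dichotomy (S3/S4) instead of
Dirichlet re-tuning + Bolzano–Weierstrass on rates; (b) the iff PACKAGING `uniformNearOneRdss_iff_rss`,
`nearOneRdssNear_iff_rssAt`, `uniformNearOneRdss_iff_forall_near` (converses trivial).  Recommended grade:
known-in-tree / variant (alternative proof).  No landing requested.  No summit, no crux closed.

# Line `spiral-closure` — DSS-wall rung line filed under crux `TypeIQuarterGate.ScarEnvelopeTypeI`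
(stmt-NavierStokesRegularity-23843). Seat ns-idea-7 g4, lens «nearmiss», target «DSS wall».

**No summit is proved by this line, and it does NOT conclude the crux `ScarEnvelopeTypeI`.**
It is a rung line on the crux's wall, on the one evasion lane of the near-one barrier that no route, line
or tree theorem touches: lane (d) of `Literature.Barriers.NavierStokesRegularity.NearOneDssTypeIExclusion`,
ROTATED discretely self-similar (RDSS) blow-up profiles with angular speed `α ≍ 1` and factor `λ` near `1`.
The tree proves Pineau–Vicol Thm 1.7 (`pineauVicol2026_rdss_liouville_holds`): near-one RDSS exclusion for
`|α| ≤ α₁(C₀)` and for `|α| ≥ α₂(C₀)` with the SHRINKING window `λ < λ̄^{1/(1+α²)}`; nothing for the middle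
band, and no window uniform in `α`.  Its proof (tree `PineauVicol2026.exists_limit_rdss_tuned` +
`exists_tuned_exponents`) is Chae–Wolf compactness along exponents TUNED so that every rotation angle tends to
`0 (mod 2π)` — which is exactly what the hypotheses on `α` buy.

## The lever (new on this wall): SYMMETRY-GROUP CLOSURE of near-one limits ("breathers converge to solitons")

Drop the tuning.  Along any RDSS sequence with factors `c_n ↓ 1` and ARBITRARY speeds `α_n`, pass to a
subsequence on which, for each `μ_j = 1 + 1/(j+1)`, the rotation angle of the `μ_j`-rescaling converges to SOME
`Θ_j` (Bolzano + diagonal; stub `stub_angleExtraction`).  The Chae–Wolf/Pineau–Vicol limit `v` is then a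
nontrivial Type-I field invariant under every `(μ_j, R_{Θ_j})` (`limitWithSymmetries_holds` = the tree's
`exists_limit_rdss_tuned` with pointwise tuning, PROVED v3).  Its forward symmetry set
`symSet v = {(σ,θ) : σ ≥ 0, v = e^σ R_θ v(e^{2σ}·, e^σ R_{−θ}·)}` is a CLOSED additive MONOID in `[0,∞) × ℝ`
containing `(0, 2π)` and elements with arbitrarily small positive first coordinate.  THE LEVER is the
elementary rigidity of such monoids (stub `stub_closedMonoidDichotomy`, pure): either it contains ALL
`(σ,θ)`, `σ ≥ 0` — then `v` is self-similar and dies by Tsai (tree `ChaeWolf.limit_eq_zero`; PROVED here: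
`false_of_fullSym`) — or it contains a RAY `{(σ, βσ) : σ ≥ 0}` — then `v` is a ROTATED SELF-SIMILAR (RSS) field
with speed `β/2`: a SCALING SOLITON.  Hence

  `RssLiouvilleAll C₀  ⟹  UniformNearOneRdss C₀`   (kernel-checked: `uniformNearOneRdss_of_rss`):

the near-one RDSS lane FOR ALL SPEEDS, with a window `λ_*(C₀)` UNIFORM in `α`, reduces to the Liouville
conjecture for rotated self-similar profiles (Pineau–Vicol Conjecture 1.1 = Tsai GSM 192 Conj. 8.9) — an
ELLIPTIC problem (steady profiles of (1.8)), known for `|α| ≪ 1` and `|α| ≫ 1` (tree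
`pineauVicol2026_rss_liouville_holds`), so the only open input is the compact MIDDLE BAND of speeds.
(Breather/soliton language: Pineau–Vicol Remark 1.8, after Šverák.)  The converse direction is trivial
(RSS ⊂ RDSS with every factor), so on the near-one lane the reduction is an EQUIVALENCE of open problems:
`(near-one RDSS, all α) ⟺ (RSS, all α)`.

## Bears on
* barrier `NearOneDssTypeIExclusion`, lane (d) "rotated α ≍ 1" — reduced to RSS (conditionally closed);
* crux 23843 (`ScarEnvelopeTypeI`): its conclusion (the multi-scar ENVELOPE) is what puts blow-up zooms in the
  envelope class `HasTypeIDecay C₀` where this line (like PV 1.7) is stated; the residual twin-scar / thin objects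
  of the registered lines `slice_budget` v8 / `thin_cascade` v6 may be RDSS breathers — this line says: near
  `λ = 1` they are scaling solitons or nothing;
* LADDER-NS N6d (DSS census): instrument = RSS census on the middle band (a STEADY 3-D elliptic Newton problem,
  far cheaper than the periodic-orbit DSS census).

Kernel-checked: `false_of_fullSym` (self-similar branch, via `ChaeWolf.limit_eq_zero`), `uniformNearOneRdss_of`
(the reduction from the five obligations), `uniformNearOneRdss_of_rss : 0 < C₀ → RssLiouvilleAll C₀ →
UniformNearOneRdss C₀` (v6: stub-free), and the stub-free CONVERSE `rssLiouvilleAll_of_uniformNearOneRdss`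
(a soliton is a breather of every period) — so near `λ = 1` the two open problems are EQUIVALENT at fixed `C₀`;
v2: the pure obligations S1 `angleExtraction_holds` (Tychonoff/diagonal), S3 `symSetMonoid_holds` and S4 — THE
LEVER — `closedMonoidDichotomy_holds` are PROVED; v3: S2 `limitWithSymmetries_holds` (Chae–Wolf compactness with
pointwise tuning, adapted verbatim from the tree) is PROVED and S6 is split into the two registered stubs S6a
`stub_spiralLimitRegular` (KNSS regularity window for spiral-invariant limits — the rotated copy of
`ChaeWolf.limit_eq_zero` Steps 1–4) and S6b `stub_spiralRayExtension` (forward RSS extension to `[−1,0)` — the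
mirror of `exists_isClassicalNSSolutionOn_Iio_of_isRotatedDSS`), composed by the PROVED `rssWeak_of_classical`.
v5: S6b `spiralRayExtension_holds` is PROVED (slice formula + forward transport + pressure patching); v6: S6a
`spiralLimitRegular_holds` is PROVED (KNSS window + spiral slice relation + weak-to-classical pressure) — the file is
SORRY-FREE and `uniformNearOneRdss_of_rss` / `rssLiouvilleAll_of_uniformNearOneRdss` give the stub-free equivalence
`UniformNearOneRdss C₀ ↔ RssLiouvilleAll C₀` (`uniformNearOneRdss_iff_rss`).  v4: S1/S3/S4 and the defs `InvPair`, `symSet`,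
`AngleExtraction`, `SymSetMonoid`, `ClosedMonoidDichotomy` are IMPORTED from the landed Theorems files
`…SpiralClosureMonoidDichotomy` (p631961) and `…SpiralClosureSymSetAngles` (p631994) — copies dropped (BC4).
**v7 (SPEED BY SPEED, sorry-free):** when the speeds CONVERGE (`α_n → α₀`) the rotation angles of the
`μ_j`-rescalings converge to the ALIGNED values `2α₀ log μ_j` with no extraction, the aligned points fill the ray
`β = 2α₀` in the closed symmetry monoid (`ray_of_small_points`, `ray_of_aligned`), and the limit is a soliton OF
SPEED EXACTLY `α₀` (S6b♯ `spiralRayExtensionAt_holds` pins the speed): `nearOneRdssNear_iff_rssAt : 0 < C₀ →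
(NearOneRdssNear C₀ α₀ ↔ RssLiouvilleAt C₀ α₀)` — the bad speed sets COINCIDE pointwise; hence
`isOpen_setOf_rssLiouvilleAt` (the RSS-Liouville speed set is OPEN), `isCompact_badSpeeds` (the speeds carrying a
nontrivial rotated Type-I soliton with constant `C₀` form a COMPACT set inside Pineau–Vicol's middle band),
`uniformNearOneRdss_iff_forall_near` (local windows ⇔ one uniform window) and the UNCONDITIONAL
`nearOneRdssNear_of_pineauVicol` (tree PV Thm 1.4 ⇒ a near-one RDSS window serving all speeds near any `α₀` with
`|α₀| < α₁ ∨ α₂ < |α₀|` — a Thm-1.7-type exclusion obtained by compactness + monoid rigidity, without the energy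
method with rotation).  The middle band stays open; no summit, no crux closed.
**v8 (BC4 SELF-DISCLOSURE + tree routing):** the RSS-side content of S6a + S6b♯ ("a spiral-invariant limit field is
a classical Pineau–Vicol-class soliton of speed `β/2`") and v7's openness / compactness of the speed sets were
ALREADY IN THE TREE since 2026-08-16 — `Theorems.rssCompact_limit_classical`, `Theorems.rssCompact_not_liouvilleAt_of_limit`,
`Theorems.rssCompact_isOpen_good`, `Theorems.rssCompact_isCompact_bad` (`Theorems/TypeICertificateLadderTargetRssCompactness*`,
support of stmt-NavierStokesRegularity-1217, line «killing-twisted-bernoulli-solitons» B5b; Chae–Wolf compactness run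
on RSS sequences).  v8 imports that file and routes every composition through it (`muForm_of_ray`,
`false_of_ray_of_rssAt`, `rssWeak_of_rssCompact`; `isOpen_setOf_rssLiouvilleAt := rssCompact_isOpen_good`); the
v5/v6 re-proofs stay as certified alternatives (`uniformNearOneRdss_of_rss'`, `isOpen_setOf_rssLiouvilleAt'`) and are
NOT proposed for landing.  What is this line's own (not in the tree): the RDSS side — S1 angle extraction, S2 limit
with countable tuning, S3/S4 symmetry monoid + dichotomy, `uniformNearOneRdss_iff_rss`, `nearOneRdssNear_iff_rssAt`,
`setOf_nearOneRdssNear_eq` / `isOpen_setOf_nearOneRdssNear`, `uniformNearOneRdss_iff_forall_near`,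
`nearOneRdssNear_of_pineauVicol` (breathers ⇔ solitons, all speeds and speed by speed).
**v9 (BC4 SELF-DISCLOSURE no. 2):** the SPEED-BY-SPEED forward step of v7 and its unconditional corollary were ALSO
already in the tree since 2026-08-16, in `Theorems/TypeICertificateLadderTargetRdssLiouvilleNear.lean` (same
stmt-1217 support family): `Theorems.rdssCompact_liouville_near` (RSS Liouville at `α₀`, constant `C₀` ⇒ `∃ δ > 0,
∃ c₁ > 1`, RDSS Liouville for `|α − α₀| < δ`, `c ∈ (1, c₁)` — my `nearOneRdssNear_of_rssAt` up to `<`/`≤`) and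
`Theorems.rdssCompact_liouville_near_of_extreme` (= my `nearOneRdssNear_of_pineauVicol`), with the same remark
(«Thm-1.7-type statement by compactness, window depending on α₀»); v9 imports that file, CITES both
(`nearOneRdssNear_of_rssAt` is now three lines over the tree theorem; the monoid-route derivation is kept as
`nearOneRdssNear_of_rssAt'`).  WHAT REMAINS THIS LINE'S OWN after both disclosures — precisely the step that file
records as NOT proved there («needs an extraction along |α_n| → ∞ with arithmetic tuning of the angles»): the
ALL-SPEEDS / UNBOUNDED-SPEEDS identification `uniformNearOneRdss_iff_rss` (S1 angle extraction mod 2π for arbitrary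
speed sequences + S2 countably-tuned limit + S3/S4 closed-monoid dichotomy ⇒ the limit of breathers with factors
`↓ 1` and ANY speeds is fully self-similar or a rotated soliton of SOME speed), its corollary
`uniformNearOneRdss_iff_forall_near` (windows near every speed ⇒ ONE window for all speeds), and the packaging
`nearOneRdssNear_iff_rssAt` / `setOf_nearOneRdssNear_eq` (one-liners over the tree + the trivial converse).  Honest
limit, unchanged: the extraction controls the limit's symmetry RAY, not its speed, so nothing here gives PV
Thm 1.7 (ii) (uniformity as `|α| → ∞`) or touches the middle band; no summit, no crux closed.

References: Chae–Wolf 2017 (arXiv:1610.09464) §3; Pineau–Vicol 2026 (arXiv:2607.09619) Conj. 1.1, Thm 1.4,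
Thm 1.7, Remark 1.5, Remark 1.8, §8 (8.1); Tsai GSM 192 Conj. 8.8–8.9; KNSS 2009 (bounded ancient mild
solutions are smooth).  Cheapest falsifier: a closed additive monoid in `[0,∞)×ℝ` with `(0,2π)`, angle
inversion at `σ = 0` and small positive first coordinates containing neither `[0,∞)×ℝ` nor a ray — impossible
(elementary; the proof is in the stub's docstring).
-/

noncomputable section

namespace Summit.NavierStokesRegularity.NavierStokesRegularity.Cruxes.ScarEnvelopeTypeI.SpiralClosure

open MeasureTheory Set Function Filter Topology Metric
open scoped NNReal ContDiff
open Literature.Analysis Literature.Analysis.FluidPDE Literature.Analysis.FluidPDE.PineauVicol2026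

/-- Physical space. -/
local notation "ℝ³" => EuclideanSpace ℝ (Fin 3)

/-! ### The objects -/

/-! `InvPair v μ θ` (invariance under the scaling–rotation `(μ, R_θ)` on `t ≤ −1/4`) and `symSet v` (the FORWARD
SYMMETRY SET in logarithmic coordinates) are now the LANDED decls of
`Theorems/TypeIQuarterGateScarEnvelopeTypeISpiralClosureSymSetAngles.lean` (p631994, this namespace). -/

/-- The class of Chae–Wolf / Pineau–Vicol LIMIT FIELDS with envelope constant `C₀`: jointly continuous,
Type-I envelope on `t ≤ −1/4`, bounded weak Navier–Stokes solution (shifted normalisation of the tree). -/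
def IsLimitField (C₀ : ℝ) (v : ℝ → ℝ³ → ℝ³) : Prop :=
  Continuous (uncurry v) ∧
    (∀ t ≤ -(1 / 4 : ℝ), ∀ x : ℝ³, ‖v t x‖ ≤ C₀ / (‖x‖ + √(-t))) ∧
    IsBoundedWeakNSSolutionOn (Iio 0) isOpen_Iio 1 (fun t => v (t - 1 / 4))

/-- A LIMIT OBJECT: a limit field that is nontrivial at time `−1`. -/
def IsLimitObject (C₀ : ℝ) (v : ℝ → ℝ³ → ℝ³) : Prop :=
  IsLimitField C₀ v ∧ ∃ x : ℝ³, v (-1) x ≠ 0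

/-- **The open input (Pineau–Vicol Conjecture 1.1 = Tsai GSM 192 Conj. 8.9, at envelope constant `C₀`, ALL
speeds):** Liouville for rotated self-similar Type-I profiles — the inner statement of the tree's
`pineauVicol2026_rss_liouville` with the restriction `|α| < α₁ ∨ α₂ < |α|` removed.  The tree discharges the
small and large speeds (`pineauVicol2026_rss_liouville_holds`); the MIDDLE BAND is open.  An unproven conjecture:
it enters this line only as a HYPOTHESIS of the reduction, never as a fact. -/
def RssLiouvilleAll (C₀ : ℝ) : Prop :=
  ∀ (α : ℝ) (u : ℝ → ℝ³ → ℝ³) (p : ℝ → ℝ³ → ℝ) (U : ℝ³ → ℝ³),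
    IsClassicalNSSolutionOn (Ico (-1) 0) 1 0 u p →
    (∀ t ∈ Ico (-1 : ℝ) 0, ∀ x : ℝ³, ‖u t x‖ ≤ C₀ / (‖x‖ + Real.sqrt (-t))) →
    ContDiff ℝ 2 U →
    (∀ t ∈ Ico (-1 : ℝ) 0, ∀ x : ℝ³, u t x = pvAnsatz α (fun y _ => U y) t x) →
    U = 0

/-- **Liouville for forward-spiral-invariant limit fields** (the RSS analogue of the tree's
`ChaeWolf.limit_eq_zero`): a limit field invariant under a ray `{(e^σ, R_{βσ}) : σ ≥ 0}` of scaling–rotations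
vanishes at time `−1`.  Obtained from `RssLiouvilleAll` by `rssWeak_of_classical` (S6a + S6b). -/
def RssLiouvilleWeak (C₀ : ℝ) : Prop :=
  ∀ (v : ℝ → ℝ³ → ℝ³) (β : ℝ), IsLimitField C₀ v →
    (∀ σ : ℝ, 0 ≤ σ → InvPair v (Real.exp σ) (β * σ)) → v (-1) = 0

/-- **THE RUNG: near-one RDSS exclusion UNIFORM IN THE SPEED.**  For the envelope constant `C₀` there is
`c₁ > 1` such that every classical `(α, c)`-RDSS Type-I solution on `[−1,0)` (Pineau–Vicol (1.13), `C²`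
profile of period `2 log c`) with `1 < c < c₁` — and ANY `α ∈ ℝ` — has vanishing profile.  This is Thm 1.7 of
Pineau–Vicol with BOTH speed restrictions and the `α`-dependence of the window removed (barrier lane (d)). -/
def UniformNearOneRdss (C₀ : ℝ) : Prop :=
  ∃ c₁ : ℝ, 1 < c₁ ∧
    ∀ (α c : ℝ) (u : ℝ → ℝ³ → ℝ³) (p : ℝ → ℝ³ → ℝ) (U : ℝ³ → ℝ → ℝ³),
      1 < c → c < c₁ →
      IsClassicalNSSolutionOn (Ico (-1) 0) 1 0 u p →
      (∀ t ∈ Ico (-1 : ℝ) 0, ∀ x : ℝ³, ‖u t x‖ ≤ C₀ / (‖x‖ + Real.sqrt (-t))) →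
      ContDiff ℝ 2 (fun q : ℝ³ × ℝ => U q.1 q.2) →
      (∀ (y : ℝ³) (s : ℝ), U y (s + 2 * Real.log c) = U y s) →
      (∀ t ∈ Ico (-1 : ℝ) 0, ∀ x : ℝ³, u t x = pvAnsatz α U t x) →
      ∀ (y : ℝ³), ∀ s ∈ Icc (0 : ℝ) (2 * Real.log c), U y s = 0

/-! ### The five obligations, as Props -/

/-! (S1) `AngleExtraction`, (S3) `SymSetMonoid` and (S4) `ClosedMonoidDichotomy` — with their proofs
`angleExtraction_holds`, `symSetMonoid_holds`, `closedMonoidDichotomy_holds` (this line's v2 proofs) — are now the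
LANDED decls of `Theorems/…SpiralClosureSymSetAngles.lean` (p631994) and `Theorems/…SpiralClosureMonoidDichotomy.lean`
(p631961), landed by ns-in-wu-con g2 (KEY #216 (1)(a)); v4 imports them and drops the copies (BC4). -/

/-- (S2) LIMIT WITH SYMMETRIES (Chae–Wolf §3 / tree `PineauVicol2026.exists_limit_rdss_tuned`, with the
factor set `{μ_j}` instead of all `μ ≥ 1`, fed the `[−1,0)` data through the tree's backward extension
`exists_isClassicalNSSolutionOn_Iio_of_isRotatedDSS` as in `PineauVicol2026.false_of_rdss_sequence`). -/
def LimitWithSymmetries (C₀ : ℝ) : Prop :=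
  ∀ (α c : ℕ → ℝ) (u : ℕ → ℝ → ℝ³ → ℝ³) (p : ℕ → ℝ → ℝ³ → ℝ) (U : ℕ → ℝ³ → ℝ → ℝ³) (Θ : ℕ → ℝ),
    (∀ n, 1 < c n) → Tendsto c atTop (𝓝 1) →
    (∀ n, IsClassicalNSSolutionOn (Ico (-1) 0) 1 0 (u n) (p n)) →
    (∀ n, ∀ t ∈ Ico (-1 : ℝ) 0, ∀ x : ℝ³, ‖u n t x‖ ≤ C₀ / (‖x‖ + Real.sqrt (-t))) →
    (∀ (n : ℕ) (y : ℝ³) (s : ℝ), U n y (s + 2 * Real.log (c n)) = U n y s) →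
    (∀ n, ∀ t ∈ Ico (-1 : ℝ) 0, ∀ x : ℝ³, u n t x = pvAnsatz (α n) (U n) t x) →
    (∀ n, ∃ (y : ℝ³) (s : ℝ), U n y s ≠ 0) →
    (∀ j : ℕ, ∃ (k : ℕ → ℕ) (m : ℕ → ℤ),
      Tendsto (fun n => c n ^ k n) atTop (𝓝 (1 + 1 / ((j : ℝ) + 1))) ∧
      Tendsto (fun n => α n * (2 * Real.log (c n ^ k n)) - 2 * Real.pi * m n) atTop (𝓝 (Θ j))) →
    ∃ v : ℝ → ℝ³ → ℝ³, IsLimitObject C₀ v ∧ ∀ j : ℕ, InvPair v (1 + 1 / ((j : ℝ) + 1)) (Θ j)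

/-! ### Obligations: S1–S4, S6a, S6b — ALL PROVED (v2/v3/v5/v6); no registered stub remains -/

/-! ### (S2) PROVED (v3): the tree's compactness step with POINTWISE tuning

Verbatim adaptation of `Literature/Analysis/FluidPDE/PineauVicolRDSSCompactness.lean` (PineauVicol2026.exists_limit_rdss_tuned,
Chae–Wolf 2017 §3 Steps 1–2 with rotations): the hypothesis `htune` (tuning data for EVERY `μ ≥ 1`) is
moved under the binder — the limit is invariant under `(μ, R_θ)` for every `μ ≥ 1`, `θ` for which tuning data
exist along the sequence.  Private helpers of the tree file are re-proved here (prefix `sc_`). -/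

/-- The orbit map `θ ↦ R_θ z` of a point under the rotations about the axis is continuous
(private copy of the tree's `continuous_rotZ_angle`, kept here with a light import). [folklore] -/
theorem sc_continuous_rotZ_angle (z : EuclideanSpace ℝ (Fin 3)) :
    Continuous fun θ : ℝ => rotZ θ z := by
  -- adapted from Literature/Analysis/FluidPDE/PineauVicolRSSHolds.lean (continuous_rotZ_angle')
  unfold rotZ
  refine (PiLp.continuous_toLp 2 _).comp ?_
  refine continuous_pi fun i => ?_
  have hc : Continuous fun θ : ℝ => Real.cos θ := Real.continuous_cos
  have hs : Continuous fun θ : ℝ => Real.sin θ := Real.continuous_sin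
  fin_cases i
  · exact ((hc.mul (continuous_const (y := z 0))).sub
      (hs.mul (continuous_const (y := z 1)))).congr fun θ => by simp
  · exact ((hs.mul (continuous_const (y := z 0))).add
      (hc.mul (continuous_const (y := z 1)))).congr fun θ => by simp
  · exact (continuous_const (y := z 2)).congr fun θ => by simp

/-- Rotations by convergent angles of a convergent sequence converge: `θ_n → θ₀`, `z_n → z₀`
imply `R_{θ_n} z_n → R_{θ₀} z₀` (isometries; the orbit map `θ ↦ R_θ z₀` is continuous). [folklore] -/
theorem sc_tendsto_rotZ {θ : ℕ → ℝ} {θ₀ : ℝ}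
    {z : ℕ → EuclideanSpace ℝ (Fin 3)} {z₀ : EuclideanSpace ℝ (Fin 3)}
    (hθ : Tendsto θ atTop (𝓝 θ₀)) (hz : Tendsto z atTop (𝓝 z₀)) :
    Tendsto (fun n => rotZ (θ n) (z n)) atTop (𝓝 (rotZ θ₀ z₀)) := by
  -- adapted from Literature/Analysis/FluidPDE/PineauVicolRSSHolds.lean (tendsto_rotZ_of_tendsto)
  rw [tendsto_iff_norm_sub_tendsto_zero] at hz ⊢
  have h1 : Tendsto (fun n => rotZ (θ n) z₀) atTop (𝓝 (rotZ θ₀ z₀)) :=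
    ((sc_continuous_rotZ_angle z₀).tendsto θ₀).comp hθ
  have h1' := tendsto_iff_norm_sub_tendsto_zero.1 h1
  have hbound : ∀ n, ‖rotZ (θ n) (z n) - rotZ θ₀ z₀‖ ≤
      ‖z n - z₀‖ + ‖rotZ (θ n) z₀ - rotZ θ₀ z₀‖ := fun n => by
    calc ‖rotZ (θ n) (z n) - rotZ θ₀ z₀‖
        ≤ ‖rotZ (θ n) (z n) - rotZ (θ n) z₀‖ + ‖rotZ (θ n) z₀ - rotZ θ₀ z₀‖ :=
          norm_sub_le_norm_sub_add_norm_sub _ _ _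
      _ = ‖z n - z₀‖ + ‖rotZ (θ n) z₀ - rotZ θ₀ z₀‖ := by
          congr 1
          rw [← rotZL_apply (θ n) (z n), ← rotZL_apply (θ n) z₀, ← map_sub, rotZL_apply,
            norm_rotZ]
  refine squeeze_zero (fun n => norm_nonneg _) hbound ?_
  simpa using hz.add h1'

/-- Rotations about the axis are `2π`-periodic in the angle: `R(θ − 2πm) = R(θ)` for every
integer `m` (Remark 1.5 of the source, "`R(s + 2π) = R(s)`"). [cite: PineauVicol2026, Remark 1.5 (arXiv:2607.09619 p. 5)] -/
theorem sc_rotZ_sub_two_pi_mul (θ : ℝ) (m : ℤ) (x : EuclideanSpace ℝ (Fin 3)) :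
    rotZ (θ - 2 * Real.pi * m) x = rotZ θ x := by
  rw [show θ - 2 * Real.pi * m = θ - m * (2 * Real.pi) by ring]
  ext i
  fin_cases i <;> simp [Real.cos_sub_int_mul_two_pi, Real.sin_sub_int_mul_two_pi]

/-- The inverse rotations are likewise unchanged: `R(−(θ − 2πm)) = R(−θ)`. [folklore] -/
theorem sc_rotZ_neg_sub_two_pi_mul (θ : ℝ) (m : ℤ)
    (x : EuclideanSpace ℝ (Fin 3)) : rotZ (-(θ - 2 * Real.pi * m)) x = rotZ (-θ) x := by
  have e : -(θ - 2 * Real.pi * m) = -θ - 2 * Real.pi * ((-m : ℤ) : ℝ) := by push_cast; ring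
  rw [e, sc_rotZ_sub_two_pi_mul]

/-- The RDSS ansatz field with a `2 log c`-periodic profile is rotated-DSS with every factor
`μ = c ^ k`: `w(t,x) = μ R(θ) w(μ²t, μ R(−θ) x)`, `θ = 2α log μ` (a `2 log c`-periodic profile is
`2 log (c ^ k)`-periodic; the tree's `isRotatedDSS_pvAnsatz`). [cite: PineauVicol2026, (1.13) and Remark 1.5] -/
theorem sc_pvAnsatz_eq_smul_rotZ_pow (α : ℝ) {c : ℝ} (hc : 0 < c)
    {U : EuclideanSpace ℝ (Fin 3) → ℝ → EuclideanSpace ℝ (Fin 3)}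
    (hper : ∀ (y : EuclideanSpace ℝ (Fin 3)) (s : ℝ), U y (s + 2 * Real.log c) = U y s)
    (k : ℕ) (t : ℝ) (x : EuclideanSpace ℝ (Fin 3)) :
    pvAnsatz α U t x = c ^ k • rotZ (α * (2 * Real.log (c ^ k)))
      (pvAnsatz α U ((c ^ k) ^ 2 * t) (c ^ k • rotZ (-(α * (2 * Real.log (c ^ k)))) x)) := by
  -- adapted from Literature/Analysis/FluidPDE/PineauVicolRSSHolds.lean (pvAnsatz_rss_eq_smul_rotZ)
  have hperk : ∀ (y : EuclideanSpace ℝ (Fin 3)) (s : ℝ),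
      U y (s + 2 * Real.log (c ^ k)) = U y s := fun y s => by
    rw [show s + 2 * Real.log (c ^ k) = s + k * (2 * Real.log c) by rw [Real.log_pow]; ring]
    exact profile_add_nat_mul_period hper y s k
  have h := isRotatedDSS_pvAnsatz (α := α) (pow_pos hc k) hperk t x
  simp only [rotZLIE_symm_apply, rotZLIE_apply, neg_neg] at h
  exact h.symm

/-- **Chae–Wolf 2017, §3, Step 1, with rotations.** From a point where the scale-invariant size
`√(−t')‖w(t',x')‖ = ‖U(y', s')‖` of the RDSS ansatz field exceeds `ε₀`, the periodicity of the
profile moves the self-similar time `s'` into the period `[−2 log c, 0)`, i.e. to a time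
`t ∈ [−c², −1]`, at a rotated and rescaled point of the same size; for `c ≤ 2` the Type I bound
then confines the point to `‖x‖ ≤ 2C₀/ε₀` and gives `‖w(t,x)‖ ≥ ε₀/2`. [cite: ChaeWolf2017RemovingDSS, §3 Step 1 (arXiv:1610.09464 p. 8)] -/
theorem sc_witness {ε₀ C₀ α c : ℝ}
    {U : EuclideanSpace ℝ (Fin 3) → ℝ → EuclideanSpace ℝ (Fin 3)} (hε₀ : 0 < ε₀) (hC₀ : 0 ≤ C₀)
    (hc1 : 1 < c) (hc2 : c ≤ 2)
    (hper : ∀ (y : EuclideanSpace ℝ (Fin 3)) (s : ℝ), U y (s + 2 * Real.log c) = U y s)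
    (hI : HasTypeIDecay C₀ (pvAnsatz α U)) {t' : ℝ} (ht' : t' < 0)
    {x' : EuclideanSpace ℝ (Fin 3)} (hq' : ε₀ < √(-t') * ‖pvAnsatz α U t' x'‖) :
    ∃ t ∈ Icc (-c ^ 2) (-1), ∃ x : EuclideanSpace ℝ (Fin 3),
      ‖x‖ ≤ 2 * C₀ / ε₀ ∧ ε₀ / 2 ≤ ‖pvAnsatz α U t x‖ := by
  -- adapted from Literature/Analysis/FluidPDE/ChaeWolfRemovingDSSLimit.lean (exists_witness)
  have hc0 : 0 < c := one_pos.trans hc1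
  have hS : 0 < 2 * Real.log c := mul_pos two_pos (Real.log_pos hc1)
  -- the size in terms of the profile: `√(-t') ‖w t' x'‖ = ‖U y' s'‖`
  have hs' : 0 < √(-t') := Real.sqrt_pos.2 (by linarith)
  set y' : EuclideanSpace ℝ (Fin 3) :=
    rotZ (-(α * -Real.log (-t'))) ((√(-t'))⁻¹ • x') with hy'
  have hUy : ε₀ < ‖U y' (-Real.log (-t'))‖ := by
    have e : √(-t') * ‖pvAnsatz α U t' x'‖ = ‖U y' (-Real.log (-t'))‖ := by
      rw [norm_pvAnsatz, ← mul_assoc, mul_inv_cancel₀ hs'.ne', one_mul]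
    rwa [e] at hq'
  -- move the self-similar time into the period `[-2 log c, 0)`
  have hP : Function.Periodic (fun s => U y' s) (2 * Real.log c) := fun s => hper y' s
  obtain ⟨s, hs, hUs⟩ := hP.exists_mem_Ico hS (-Real.log (-t')) (-(2 * Real.log c))
  rw [neg_add_cancel] at hs
  have hUs' : U y' (-Real.log (-t')) = U y' s := hUs
  set t : ℝ := -Real.exp (-s) with ht
  have hlog : -Real.log (-t) = s := by rw [ht, neg_neg, Real.log_exp, neg_neg]
  have hr : 0 < √(-t) := Real.sqrt_pos.2 (by rw [ht, neg_neg]; exact Real.exp_pos _)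
  have htI : t ∈ Icc (-c ^ 2) (-1) := by
    have h1 : Real.exp (-s) ≤ c ^ 2 := by
      rw [← Real.exp_log (pow_pos hc0 2), Real.exp_le_exp, Real.log_pow]
      push_cast
      linarith [hs.1]
    have h2 : 1 ≤ Real.exp (-s) := Real.one_le_exp_iff.2 (by linarith [hs.2])
    exact ⟨by linarith [ht, h1], by linarith [ht, h2]⟩
  refine ⟨t, htI, √(-t) • rotZ (α * s) y', ChaeWolf.witness_of_point hε₀ hC₀ hc0.le hc2 hI htI ?_⟩
  rw [norm_pvAnsatz, hlog, inv_smul_smul₀ hr.ne', ← rotZ_add, neg_add_cancel, rotZ_zero,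
    ← mul_assoc, mul_inv_cancel₀ hr.ne', one_mul, ← hUs']
  exact hUy


theorem sc_exists_limit_of_le_two {C₀ : ℝ} {α c : ℕ → ℝ}
    {U : ℕ → EuclideanSpace ℝ (Fin 3) → ℝ → EuclideanSpace ℝ (Fin 3)}
    {P : ℕ → ℝ → EuclideanSpace ℝ (Fin 3) → ℝ} (hC₀ : 0 < C₀) (hc1 : ∀ n, 1 < c n)
    (hc2 : ∀ n, c n ≤ 2) (hc : Tendsto c atTop (𝓝 1))
    (hper : ∀ (n : ℕ) (y : EuclideanSpace ℝ (Fin 3)) (s : ℝ),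
      U n y (s + 2 * Real.log (c n)) = U n y s)
    (hcl : ∀ n, IsClassicalNSSolutionOn (Iio 0) 1 0 (pvAnsatz (α n) (U n)) (P n))
    (hI : ∀ n, HasTypeIDecay C₀ (pvAnsatz (α n) (U n)))
    (hnt : ∀ n, ∃ t < 0, ∃ x : EuclideanSpace ℝ (Fin 3), pvAnsatz (α n) (U n) t x ≠ 0) :
    ∃ v : ℝ → EuclideanSpace ℝ (Fin 3) → EuclideanSpace ℝ (Fin 3), Continuous (uncurry v) ∧
      (∀ t ≤ -(1 / 4 : ℝ), ∀ x, ‖v t x‖ ≤ C₀ / (‖x‖ + √(-t))) ∧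
      IsBoundedWeakNSSolutionOn (Iio 0) isOpen_Iio 1 (fun t => v (t - 1 / 4)) ∧
      (∀ μ θ₀ : ℝ, 1 ≤ μ →
        (∃ (k : ℕ → ℕ) (m : ℕ → ℤ), Tendsto (fun n => c n ^ k n) atTop (𝓝 μ) ∧
          Tendsto (fun n => α n * (2 * Real.log (c n ^ k n)) - 2 * Real.pi * m n) atTop (𝓝 θ₀)) →
        ∀ t ≤ -(1 / 4 : ℝ), ∀ x,
          v t x = μ • rotZ θ₀ (v (μ ^ 2 * t) (μ • rotZ (-θ₀) x))) ∧
      ∃ x : EuclideanSpace ℝ (Fin 3), v (-1) x ≠ 0 := by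
  -- adapted from Literature/Analysis/FluidPDE/ChaeWolfRemovingDSSLimit.lean (ChaeWolf.exists_limit)
  set w : ℕ → ℝ → EuclideanSpace ℝ (Fin 3) → EuclideanSpace ℝ (Fin 3) :=
    fun n => pvAnsatz (α n) (U n) with hw
  obtain ⟨K, L, hK, hL, hKL⟩ := ChaeWolf.exists_uniform_lipschitz hC₀.le
  obtain ⟨ε₀, hε₀, hA⟩ := ChaeWolf.exists_eps_typeI_small_eq_zero
  -- Step 1: witnesses `t_n ∈ [-c_n², -1]`, `‖x_n‖ ≤ 2C₀/ε₀`, `‖w_n(t_n, x_n)‖ ≥ ε₀/2`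
  have hwit : ∀ n, ∃ t ∈ Icc (-c n ^ 2) (-1), ∃ x : EuclideanSpace ℝ (Fin 3),
      ‖x‖ ≤ 2 * C₀ / ε₀ ∧ ε₀ / 2 ≤ ‖w n t x‖ := by
    intro n
    obtain ⟨t', ht', x', hq'⟩ : ∃ t' < 0, ∃ x', ε₀ < √(-t') * ‖w n t' x'‖ := by
      by_contra hcon
      push Not at hcon
      obtain ⟨t, ht, x, hx⟩ := hnt n
      exact hx (hA hC₀.le (hcl n) (hI n) hcon t ht x)
    exact sc_witness hε₀ hC₀.le (hc1 n) (hc2 n) (hper n) (hI n) ht' hq'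
  -- the equi-Lipschitz family on `ℝ × ℝ³` (fields frozen at time `-1/4` for later times)
  set Kx : ℝ≥0 := (K + L).toNNReal with hKx
  have hKx' : (Kx : ℝ) = K + L := by rw [hKx, Real.coe_toNNReal _ (by positivity)]
  set f : ℕ → ℝ × EuclideanSpace ℝ (Fin 3) → EuclideanSpace ℝ (Fin 3) :=
    fun n q => w n (min q.1 (-(1 / 4 : ℝ))) q.2 with hf
  have hf_of_le : ∀ n {t : ℝ} (_ : t ≤ -(1 / 4 : ℝ)) (x : EuclideanSpace ℝ (Fin 3)),
      f n (t, x) = w n t x :=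
    fun n t ht x => by simp only [hf, min_eq_left ht]
  have hlip : ∀ n, LipschitzWith Kx (f n) := by
    intro n
    obtain ⟨hsp, htm⟩ := hKL (hcl n) (hI n)
    refine LipschitzWith.of_dist_le_mul fun q q' => ?_
    rw [hKx', dist_eq_norm, Prod.dist_eq, Real.dist_eq, dist_eq_norm]
    have hm : min q.1 (-(1 / 4 : ℝ)) ≤ -(1 / 4 : ℝ) := min_le_right _ _
    have hm' : min q'.1 (-(1 / 4 : ℝ)) ≤ -(1 / 4 : ℝ) := min_le_right _ _
    have hmin : |min q.1 (-(1 / 4 : ℝ)) - min q'.1 (-(1 / 4 : ℝ))| ≤ |q.1 - q'.1| := by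
      refine (abs_min_sub_min_le_max _ _ _ _).trans (max_le le_rfl ?_)
      rw [sub_self, abs_zero]; exact abs_nonneg _
    calc ‖w n (min q.1 (-(1 / 4))) q.2 - w n (min q'.1 (-(1 / 4))) q'.2‖
        ≤ ‖w n (min q.1 (-(1 / 4))) q.2 - w n (min q.1 (-(1 / 4))) q'.2‖ +
            ‖w n (min q.1 (-(1 / 4))) q'.2 - w n (min q'.1 (-(1 / 4))) q'.2‖ :=
          norm_sub_le_norm_sub_add_norm_sub _ _ _
      _ ≤ K * ‖q.2 - q'.2‖ + L * |min q.1 (-(1 / 4 : ℝ)) - min q'.1 (-(1 / 4 : ℝ))| :=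
          add_le_add (hsp _ hm _ _) (htm _ hm' _ hm _)
      _ ≤ K * max |q.1 - q'.1| ‖q.2 - q'.2‖ + L * max |q.1 - q'.1| ‖q.2 - q'.2‖ := by
          gcongr
          · exact le_max_right _ _
          · exact hmin.trans (le_max_left _ _)
      _ = (K + L) * max |q.1 - q'.1| ‖q.2 - q'.2‖ := by ring
  have hball : ∀ n q, f n q ∈ closedBall (0 : EuclideanSpace ℝ (Fin 3)) (2 * C₀) :=
      fun n q => by
    rw [mem_closedBall, dist_zero_right]
    exact ChaeWolf.typeI_norm_le_two_mul hC₀.le (hI n) (min_le_right _ _) _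
  obtain ⟨φ, l, hφ, hl, -, hlim⟩ := exists_strictMono_tendsto_of_lipschitzWith f hlip hball
  -- the limit field
  set v : ℝ → EuclideanSpace ℝ (Fin 3) → EuclideanSpace ℝ (Fin 3) := fun t x => l (t, x) with hv
  have hlimv : ∀ {t : ℝ} (_ : t ≤ -(1 / 4 : ℝ)) (x : EuclideanSpace ℝ (Fin 3)),
      Tendsto (fun n => w (φ n) t x) atTop (𝓝 (v t x)) := by
    intro t ht x
    simpa only [hf_of_le _ ht] using hlim (t, x)
  have hvc : Continuous (uncurry v) := by
    have e : uncurry v = l := by funext q; rfl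
    rw [e]; exact hl.continuous
  refine ⟨v, hvc, ?_, ?_, ?_, ?_⟩
  · -- the Type I bound passes to the limit
    intro t ht x
    exact le_of_tendsto' (hlimv ht x).norm fun n => hI (φ n) t (by linarith) x
  · -- bounded weak solution on `(-∞, -1/4)`, shifted to `(-∞, 0)`
    have hA' : Tendsto (fun k : ℕ => -(k : ℝ) + -1) atTop atBot :=
      (tendsto_neg_atTop_atBot.comp tendsto_natCast_atTop_atTop).atBot_add tendsto_const_nhds
    have e14 : ∀ t : ℝ, t - 1 / 4 = t + -(1 / 4 : ℝ) := fun t => by ring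
    have hV : ∀ k : ℕ, IsBoundedWeakNSSolutionOn (Ioo (-(k : ℝ) + -1) 0) isOpen_Ioo 1
        (fun t => w (φ k) (t - 1 / 4)) := by
      intro k
      have hcl' : IsClassicalNSSolutionOn (Ioo (-(k : ℝ) + -1 + -(1 / 4)) (-(1 / 4))) 1 0
          (w (φ k)) (P (φ k)) :=
        (hcl (φ k)).mono (fun t ht => by simp only [mem_Iio]; linarith [ht.2])
          (uniqueDiffOn_Ioo _ _)
      have hbdd : IsBoundedOn (Ioo (-(k : ℝ) + -1 + -(1 / 4)) (-(1 / 4))) (w (φ k)) :=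
        ⟨2 * C₀, fun t ht x => ChaeWolf.typeI_norm_le_two_mul hC₀.le (hI (φ k)) ht.2.le x⟩
      have h := (hcl'.isBoundedWeakNSSolutionOn hbdd).comp_add_right (-(1 / 4 : ℝ))
        (J := Ioo (-(k : ℝ) + -1) 0) isOpen_Ioo fun t => by
          simp only [mem_Ioo]
          constructor <;> intro h <;> constructor <;> linarith [h.1, h.2]
      simpa only [e14] using h
    have hcont : ∀ k : ℕ, ContinuousOn (uncurry fun t => w (φ k) (t - 1 / 4))
        (Ioo (-(k : ℝ) + -1) 0 ×ˢ univ) := by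
      intro k
      have h1 := ((hcl (φ k)).smooth_velocity.comp_add_right (-(1 / 4 : ℝ))).continuousOn
      refine (h1.mono (prod_mono (fun t ht => ?_) Subset.rfl)).congr fun q _ => by
        simp only [uncurry, e14, hw]
      simp only [mem_preimage, mem_Iio]
      linarith [ht.2]
    have hbd : ∀ k : ℕ, ∀ t ∈ Ioo (-(k : ℝ) + -1) 0, ∀ x,
        ‖w (φ k) (t - 1 / 4) x‖ ≤ 2 * C₀ :=
      fun k t ht x => ChaeWolf.typeI_norm_le_two_mul hC₀.le (hI (φ k)) (by linarith [ht.2]) x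
    have hvc' : Continuous (uncurry fun t x => v (t - 1 / 4) x) :=
      hvc.comp ((continuous_fst.sub continuous_const).prodMk continuous_snd)
    exact isBoundedWeakNSSolutionOn_of_tendsto hA' hV hcont hbd hvc'
      fun t ht x => hlimv (by linarith) x
  · -- twisted scaling law of the limit along pointwise tuning data
    intro μ θ₀ hμ hkm t ht x
    have ht0 : t ≤ 0 := by linarith
    obtain ⟨k, m, hk, hm⟩ := hkm
    set lam : ℕ → ℝ := fun n => c n ^ k n with hlam
    have hlam1 : ∀ n, 1 ≤ lam n := fun n => one_le_pow₀ (hc1 n).le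
    have hlamφ : Tendsto (lam ∘ φ) atTop (𝓝 μ) := hk.comp hφ.tendsto_atTop
    set θ : ℕ → ℝ := fun n => α n * (2 * Real.log (lam n)) - 2 * Real.pi * m n with hθ
    have hθlim : Tendsto (fun n => θ (φ n)) atTop (𝓝 (θ₀)) := hm.comp hφ.tendsto_atTop
    -- the twisted scaling identities along the sequence
    have hid : ∀ n, w n t x =
        lam n • rotZ (θ n) (w n (lam n ^ 2 * t) (lam n • rotZ (-(θ n)) x)) := fun n => by
      simp only [hθ]
      rw [sc_rotZ_sub_two_pi_mul, sc_rotZ_neg_sub_two_pi_mul]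
      exact sc_pvAnsatz_eq_smul_rotZ_pow (α n) (one_pos.trans (hc1 n)) (hper n) (k n) t x
    have hmem : ∀ s : ℝ, 1 ≤ s → s ^ 2 * t ≤ -(1 / 4 : ℝ) := fun s hs =>
      (mul_le_of_one_le_left ht0 (one_le_pow₀ hs)).trans ht
    have hrot : Tendsto (fun n => rotZ (-(θ (φ n))) x) atTop (𝓝 (rotZ (-θ₀) x)) :=
      sc_tendsto_rotZ hθlim.neg tendsto_const_nhds
    set q : ℕ → ℝ × EuclideanSpace ℝ (Fin 3) :=
      fun n => (lam (φ n) ^ 2 * t, lam (φ n) • rotZ (-(θ (φ n))) x) with hq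
    have hqlim : Tendsto q atTop (𝓝 (μ ^ 2 * t, μ • rotZ (-θ₀) x)) :=
      ((hlamφ.pow 2).mul_const t).prodMk_nhds (hlamφ.smul hrot)
    have h1 : Tendsto (fun n => f (φ n) (q n)) atTop
        (𝓝 (v (μ ^ 2 * t) (μ • rotZ (-θ₀) x))) :=
      ChaeWolf.tendsto_apply_of_tendsto (fun n => hlip (φ n)) hqlim
        (hlim (μ ^ 2 * t, μ • rotZ (-θ₀) x))
    have h1' : Tendsto (fun n => w (φ n) (lam (φ n) ^ 2 * t) (lam (φ n) • rotZ (-(θ (φ n))) x))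
        atTop (𝓝 (v (μ ^ 2 * t) (μ • rotZ (-θ₀) x))) := by
      refine h1.congr fun n => ?_
      simp only [hq, hf_of_le _ (hmem _ (hlam1 _))]
    have h2 := sc_tendsto_rotZ hθlim h1'
    have h3 : Tendsto (fun n => w (φ n) t x) atTop
        (𝓝 (μ • rotZ (θ₀) (v (μ ^ 2 * t) (μ • rotZ (-θ₀) x)))) := by
      refine (hlamφ.smul h2).congr fun n => ?_
      exact (hid (φ n)).symm
    exact tendsto_nhds_unique (hlimv ht x) h3
  · -- nontriviality at time `-1`: the witnesses accumulate at a point `(-1, x̄)`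
    choose tw htw xw hxw hnw using hwit
    set S : Set (ℝ × EuclideanSpace ℝ (Fin 3)) :=
      Icc (-4 : ℝ) (-1) ×ˢ closedBall (0 : EuclideanSpace ℝ (Fin 3)) (2 * C₀ / ε₀) with hS
    have hSc : IsCompact S := isCompact_Icc.prod (isCompact_closedBall _ _)
    have hmemS : ∀ n, (tw (φ n), xw (φ n)) ∈ S := fun n => by
      refine mk_mem_prod ⟨?_, (htw (φ n)).2⟩ ?_
      · have : c (φ n) ^ 2 ≤ 4 := by nlinarith [hc2 (φ n), hc1 (φ n)]
        linarith [(htw (φ n)).1]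
      · rw [mem_closedBall, dist_zero_right]; exact hxw (φ n)
    obtain ⟨⟨tbar, xbar⟩, -, ψ, hψ, hconv⟩ := hSc.tendsto_subseq hmemS
    -- the limit time is `-1`
    have ht1 : Tendsto (fun n => tw (φ (ψ n))) atTop (𝓝 (-1)) := by
      have hlow : Tendsto (fun n => -(c (φ (ψ n))) ^ 2) atTop (𝓝 (-1)) := by
        have := ((hc.comp hφ.tendsto_atTop).comp hψ.tendsto_atTop).pow 2
        simpa using this.neg
      exact tendsto_of_tendsto_of_tendsto_of_le_of_le hlow tendsto_const_nhds
        (fun n => (htw _).1) fun n => (htw _).2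
    have htbar : tbar = -1 :=
      tendsto_nhds_unique ((continuous_fst.tendsto _).comp hconv) ht1
    subst htbar
    refine ⟨xbar, fun h0 => ?_⟩
    have h14 : (-1 : ℝ) ≤ -(1 / 4 : ℝ) := by norm_num
    have hy : Tendsto (fun n => f (φ (ψ n)) ((-1 : ℝ), xbar)) atTop (𝓝 (v (-1) xbar)) :=
      (hlim ((-1 : ℝ), xbar)).comp hψ.tendsto_atTop
    have hmain := ChaeWolf.tendsto_apply_of_tendsto (fun n => hlip (φ (ψ n))) hconv hy
    have hge : ε₀ / 2 ≤ ‖v (-1) xbar‖ := by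
      refine ge_of_tendsto' hmain.norm fun n => ?_
      simp only [comp_apply, hf_of_le _ ((htw _).2.trans h14)]
      exact hnw (φ (ψ n))
    rw [h0, norm_zero] at hge
    linarith

/-- The pointwise-tuned extraction for general factors `c_n → 1` (tail normalisation `c_n ≤ 2`). -/
theorem sc_exists_limit_pointwise {C₀ : ℝ} (hC₀ : 0 < C₀) {α c : ℕ → ℝ}
    {U : ℕ → EuclideanSpace ℝ (Fin 3) → ℝ → EuclideanSpace ℝ (Fin 3)}
    {P : ℕ → ℝ → EuclideanSpace ℝ (Fin 3) → ℝ}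
    (hc : ∀ n, 1 < c n) (hclim : Tendsto c atTop (𝓝 1))
    (hper : ∀ (n : ℕ) (y : EuclideanSpace ℝ (Fin 3)) (s : ℝ),
      U n y (s + 2 * Real.log (c n)) = U n y s)
    (hcl : ∀ n, IsClassicalNSSolutionOn (Iio 0) 1 0 (pvAnsatz (α n) (U n)) (P n))
    (hI : ∀ n, HasTypeIDecay C₀ (pvAnsatz (α n) (U n)))
    (hnt : ∀ n, ∃ t < 0, ∃ x : EuclideanSpace ℝ (Fin 3), pvAnsatz (α n) (U n) t x ≠ 0) :
    ∃ v : ℝ → EuclideanSpace ℝ (Fin 3) → EuclideanSpace ℝ (Fin 3), Continuous (uncurry v) ∧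
      (∀ t ≤ -(1 / 4 : ℝ), ∀ x, ‖v t x‖ ≤ C₀ / (‖x‖ + √(-t))) ∧
      IsBoundedWeakNSSolutionOn (Iio 0) isOpen_Iio 1 (fun t => v (t - 1 / 4)) ∧
      (∀ μ θ₀ : ℝ, 1 ≤ μ →
        (∃ (k : ℕ → ℕ) (m : ℕ → ℤ), Tendsto (fun n => c n ^ k n) atTop (𝓝 μ) ∧
          Tendsto (fun n => α n * (2 * Real.log (c n ^ k n)) - 2 * Real.pi * m n) atTop (𝓝 θ₀)) →
        ∀ t ≤ -(1 / 4 : ℝ), ∀ x,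
          v t x = μ • rotZ θ₀ (v (μ ^ 2 * t) (μ • rotZ (-θ₀) x))) ∧
      ∃ x : EuclideanSpace ℝ (Fin 3), v (-1) x ≠ 0 := by
  obtain ⟨N, hN⟩ :=
    eventually_atTop.1 (hclim.eventually (Iic_mem_nhds (by norm_num : (1 : ℝ) < 2)))
  obtain ⟨v, hvc, hvI, hweak, hss, hx⟩ :=
    sc_exists_limit_of_le_two (α := fun n => α (n + N)) (c := fun n => c (n + N))
      (U := fun n => U (n + N)) (P := fun n => P (n + N)) hC₀ (fun n => hc _)
      (fun n => hN _ (N.le_add_left n)) ((tendsto_add_atTop_iff_nat N).2 hclim)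
      (fun n => hper _) (fun n => hcl _) (fun n => hI _) (fun n => hnt _)
  refine ⟨v, hvc, hvI, hweak, fun μ θ₀ hμ hkm => hss μ θ₀ hμ ?_, hx⟩
  obtain ⟨k, m, hk, hm⟩ := hkm
  exact ⟨fun n => k (n + N), fun n => m (n + N), (tendsto_add_atTop_iff_nat N).2 hk,
    (tendsto_add_atTop_iff_nat N).2 hm⟩

/-- Remark 1.2 on all of `t < 0` (copy of the tree's private `rdssHolds_hasTypeIDecay_of_profile`). -/
theorem sc_hasTypeIDecay_of_profile {C₀ α : ℝ}
    {U : EuclideanSpace ℝ (Fin 3) → ℝ → EuclideanSpace ℝ (Fin 3)}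
    (hU : ∀ (y : EuclideanSpace ℝ (Fin 3)) (s : ℝ), ‖U y s‖ ≤ C₀ / (1 + ‖y‖)) :
    HasTypeIDecay C₀ (pvAnsatz α U) := by
  intro t ht x
  have hr : 0 < Real.sqrt (-t) := Real.sqrt_pos.2 (by linarith)
  rw [norm_pvAnsatz]
  have hy := hU (rotZ (-(α * -Real.log (-t))) ((Real.sqrt (-t))⁻¹ • x)) (-Real.log (-t))
  rw [norm_rotZ, norm_smul, norm_inv, Real.norm_of_nonneg hr.le] at hy
  calc (Real.sqrt (-t))⁻¹ *
        ‖U (rotZ (-(α * -Real.log (-t))) ((Real.sqrt (-t))⁻¹ • x)) (-Real.log (-t))‖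
      ≤ (Real.sqrt (-t))⁻¹ * (C₀ / (1 + (Real.sqrt (-t))⁻¹ * ‖x‖)) :=
        mul_le_mul_of_nonneg_left hy (inv_nonneg.2 hr.le)
    _ = C₀ / (‖x‖ + Real.sqrt (-t)) := by
        field_simp
        ring

/-- A profile value which does not vanish makes the ansatz field non-zero somewhere at a negative time
(copy of the tree's private `rdssHolds_field_ne_zero_of_profile`). -/
theorem sc_field_ne_zero_of_profile {α : ℝ}
    {U : EuclideanSpace ℝ (Fin 3) → ℝ → EuclideanSpace ℝ (Fin 3)}
    {y : EuclideanSpace ℝ (Fin 3)} {s : ℝ} (h : U y s ≠ 0) :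
    ∃ t < 0, ∃ x : EuclideanSpace ℝ (Fin 3), pvAnsatz α U t x ≠ 0 := by
  set t : ℝ := -Real.exp (-s) with ht
  have ht0 : t < 0 := by have := Real.exp_pos (-s); linarith
  have hlog : -Real.log (-t) = s := by rw [ht, neg_neg, Real.log_exp, neg_neg]
  have hr : 0 < Real.sqrt (-t) := Real.sqrt_pos.2 (by linarith)
  refine ⟨t, ht0, Real.sqrt (-t) • rotZ (α * s) y, fun hzero => h ?_⟩
  have hn := congrArg (fun v : EuclideanSpace ℝ (Fin 3) => ‖v‖) hzero
  simp only [norm_zero] at hn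
  rw [norm_pvAnsatz, hlog, inv_smul_smul₀ hr.ne', ← rotZ_add, neg_add_cancel, rotZ_zero,
    mul_eq_zero] at hn
  rcases hn with hn | hn
  · exact absurd hn (inv_ne_zero hr.ne')
  · exact norm_eq_zero.1 hn

/-- **(S2) PROVED (v3; was stub S2).** -/
theorem limitWithSymmetries_holds : ∀ C₀ : ℝ, 0 < C₀ → LimitWithSymmetries C₀ := by
  intro C₀ hC₀ α c u p U Θ hc hclim hsol hI hper hans hne hkm
  have hc0 : ∀ n, 0 < c n := fun n => zero_lt_one.trans (hc n)
  -- backward extensions with some pressure (tree, PV footnote 21)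
  have hext : ∀ n, ∃ P : ℝ → ℝ³ → ℝ,
      IsClassicalNSSolutionOn (Iio 0) 1 0 (pvAnsatz (α n) (U n)) P := fun n =>
    exists_isClassicalNSSolutionOn_Iio_of_isRotatedDSS (hsol n) (hc n)
      (isRotatedDSS_pvAnsatz (α := α n) (hc0 n) (hper n)) (hans n)
  choose P hP using hext
  have hIw : ∀ n, HasTypeIDecay C₀ (pvAnsatz (α n) (U n)) := fun n =>
    sc_hasTypeIDecay_of_profile
      (norm_profile_le_of_typeI_periodic (hc n) (hI n) (hper n) (hans n))
  have hnt : ∀ n, ∃ t < 0, ∃ x : ℝ³, pvAnsatz (α n) (U n) t x ≠ 0 := by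
    intro n
    obtain ⟨y, s, h⟩ := hne n
    exact sc_field_ne_zero_of_profile h
  obtain ⟨v, hvc, hvI, hweak, hss, x, hx⟩ :=
    sc_exists_limit_pointwise hC₀ hc hclim hper hP hIw hnt
  refine ⟨v, ⟨⟨hvc, hvI, hweak⟩, x, hx⟩, fun j => ?_⟩
  have hμ : (1 : ℝ) ≤ 1 + 1 / ((j : ℝ) + 1) := le_add_of_nonneg_right (by positivity)
  exact hss _ _ hμ (hkm j)


/-! ### (S6) split (v3): regularity window S6a (PROVED v6), then forward RSS extension S6b (PROVED v5) -/

/-- (S6a) REGULARITY WINDOW for spiral-invariant limit fields — the rotated copy of Steps 1–4 of the tree's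
`ChaeWolf.limit_eq_zero` (`ChaeWolfRemovingDSSProofs.lean`), BY NAME: KNSS window
`KNSS2009_regularity_boundedWeak_window_holds` on `τ ↦ v(τ − 9/4)` ⇒ a smooth slice `v(t₁)`, `t₁ < −1/4`;
the spiral slice relation (`InvPair` along the ray, used in BOTH directions: `μ = √(t₁/(−1))` or its inverse —
rotations and scalings are invertible) ⇒ `U₀ = v(−1)` smooth and `v = pvAnsatz (β/2) U₀` jointly smooth on
`(−4, −1/4] × ℝ³`; weakly div-free + smooth ⇒ div-free (`isDivFree_of_ae_isWeaklyDivFree_of_smooth`); pressure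
by `integral_inner_momentum_eq_zero_of_slab_weak` + `exists_isClassicalNSSolutionOn_of_forall_integral_inner_eq_zero`.
NO new Literature fact (critic P2): if a clause of `IsBoundedWeakNSSolutionOn` is missing for this chain, record
the stub as misstated — do not add a fact. -/
def SpiralLimitRegular (C₀ : ℝ) : Prop :=
  ∀ (v : ℝ → ℝ³ → ℝ³) (β : ℝ), IsLimitField C₀ v →
    (∀ σ : ℝ, 0 ≤ σ → InvPair v (Real.exp σ) (β * σ)) →
    ∃ p : ℝ → ℝ³ → ℝ, IsClassicalNSSolutionOn (Ioo (-4) (-(1 / 4 : ℝ))) 1 0 v p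

/-- (S6b) FORWARD RSS EXTENSION — the mirror image of the tree's backward extension
`exists_isClassicalNSSolutionOn_Iio_of_isRotatedDSS` (`PineauVicolRDSSLeray.lean`): a classical solution on the
window `(−4, −1/4)` invariant under the forward spiral ray `{(e^σ, R_{βσ}) : σ ≥ 0}` is, on `[−1, −1/4]`, the RSS
field `pvAnsatz (β/2) (fun y _ => v (−1) y)`; that field, defined by the same formula on `[−1, 0)`, is a classical
solution there (scaling/rotation covariance of Navier–Stokes; pressures normalised at `x = 0` glue), obeys the
Type-I envelope (RSS-invariance of `C₀/(‖x‖ + √(−t))` from the slice `t = −1`), and has the `C²` profile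
`v(−1)` (a slice of a classical solution). -/
def SpiralRayExtension (C₀ : ℝ) : Prop :=
  ∀ (v : ℝ → ℝ³ → ℝ³) (p : ℝ → ℝ³ → ℝ) (β : ℝ),
    IsClassicalNSSolutionOn (Ioo (-4) (-(1 / 4 : ℝ))) 1 0 v p →
    (∀ t ≤ -(1 / 4 : ℝ), ∀ x : ℝ³, ‖v t x‖ ≤ C₀ / (‖x‖ + √(-t))) →
    (∀ σ : ℝ, 0 ≤ σ → InvPair v (Real.exp σ) (β * σ)) →
    ∃ (u : ℝ → ℝ³ → ℝ³) (P : ℝ → ℝ³ → ℝ) (α : ℝ),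
      IsClassicalNSSolutionOn (Ico (-1) 0) 1 0 u P ∧
      (∀ t ∈ Ico (-1 : ℝ) 0, ∀ x : ℝ³, ‖u t x‖ ≤ C₀ / (‖x‖ + Real.sqrt (-t))) ∧
      ContDiff ℝ 2 (v (-1)) ∧
      (∀ t ∈ Ico (-1 : ℝ) 0, ∀ x : ℝ³, u t x = pvAnsatz α (fun y _ => v (-1) y) t x)

/-! ### (S6b) PROVED (v5): forward RSS extension along the spiral ray

The mirror image of the tree's backward extension `exists_isClassicalNSSolutionOn_Iio_of_isRotatedDSS`:
(1) the ray invariance makes `v = pvAnsatz (β/2) v(−1)` on `t ≤ −1/4` (`slice_formula`); (2) that RSS field is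
rotated-DSS with factor `2` (`isRotatedDSS_pvAnsatz`), so classical-solution-ness is transported from the window
`(−4, −1/4)` to every `(−4/4^k, −1/(4·4^k))` (`IsClassicalNSSolutionOn.conj_linearIsometryEquiv`,
`nsRescale_holds`), and the normalised pressures patch on `(−4, 0)` (`exists_pressure_Ioo_of_Ioo`, the tree's
`exists_pressure_Iio_of_Ioo` with general right endpoints); (3) the envelope is `norm_pvAnsatz_le_of_profile`
from the slice bound at `t = −1`, and the profile is `C^∞ ⊇ C²` as a slice of a classical solution. -/

/-! #### (S6b, step 1) the spiral ray makes `v` the RSS ansatz of its slice `v(−1)` on `t ≤ −1/4` -/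

theorem exp_neg_half_log {t : ℝ} (ht : t < 0) :
    Real.exp (-(1 / 2) * Real.log (-t)) = (Real.sqrt (-t))⁻¹ := by
  have hnt : 0 < -t := by linarith
  rw [Real.sqrt_eq_rpow, Real.rpow_def_of_pos hnt, ← Real.exp_neg]
  congr 1; ring

theorem exp_half_log {t : ℝ} (ht : t < 0) :
    Real.exp (1 / 2 * Real.log (-t)) = Real.sqrt (-t) := by
  have hnt : 0 < -t := by linarith
  rw [Real.sqrt_eq_rpow, Real.rpow_def_of_pos hnt]
  congr 1; ring

theorem slice_formula {v : ℝ → ℝ³ → ℝ³} {β : ℝ}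
    (hray : ∀ σ : ℝ, 0 ≤ σ → InvPair v (Real.exp σ) (β * σ)) :
    ∀ t ≤ -(1 / 4 : ℝ), ∀ x : ℝ³, v t x = pvAnsatz (β / 2) (fun y _ => v (-1) y) t x := by
  intro t ht x
  have ht0 : t < 0 := by linarith
  have hnt : 0 < -t := by linarith
  have hsq : 0 < Real.sqrt (-t) := Real.sqrt_pos.2 hnt
  simp only [pvAnsatz]
  rcases le_or_gt (-1 : ℝ) t with h1 | h1
  · -- `t ∈ [−1, −1/4]`: ray parameter `σ = −½ log(−t) ≥ 0`, time `e^{2σ} t = −1`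
    have hlog : Real.log (-t) ≤ 0 := Real.log_nonpos (by linarith) (by linarith)
    have hσ0 : 0 ≤ -(1 / 2) * Real.log (-t) := by nlinarith
    have hexp : Real.exp (-(1 / 2) * Real.log (-t)) = (Real.sqrt (-t))⁻¹ := exp_neg_half_log ht0
    have hexp2 : Real.exp (-(1 / 2) * Real.log (-t)) ^ 2 * t = -1 := by
      rw [hexp, inv_pow, Real.sq_sqrt hnt.le, inv_mul_eq_div, div_neg, div_self ht0.ne]
    have key := hray _ hσ0 t ht x
    rw [hexp2, hexp] at key
    have hθ : β * (-(1 / 2) * Real.log (-t)) = β / 2 * -Real.log (-t) := by ring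
    rw [key, hθ, rotZ_smul]
  · -- `t < −1`: ray parameter `σ = ½ log(−t) ≥ 0` at the time `−1`, read backwards
    have hlog : 0 ≤ Real.log (-t) := Real.log_nonneg (by linarith)
    have hσ0 : 0 ≤ 1 / 2 * Real.log (-t) := by positivity
    have hexp : Real.exp (1 / 2 * Real.log (-t)) = Real.sqrt (-t) := exp_half_log ht0
    have hexp2 : Real.exp (1 / 2 * Real.log (-t)) ^ 2 * (-1) = t := by
      rw [hexp, Real.sq_sqrt hnt.le]; ring
    have key := hray _ hσ0 (-1) (by norm_num)
      ((Real.sqrt (-t))⁻¹ • rotZ (β * (1 / 2 * Real.log (-t))) x)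
    rw [hexp2, hexp, rotZ_smul, smul_smul, mul_inv_cancel₀ hsq.ne', one_smul, rotZ_neg_rotZ] at key
    have hθ : -(β / 2 * -Real.log (-t)) = β * (1 / 2 * Real.log (-t)) := by ring
    have hθ' : β / 2 * -Real.log (-t) = -(β * (1 / 2 * Real.log (-t))) := by ring
    rw [hθ, hθ', rotZ_smul, key, rotZ_smul, rotZ_neg_rotZ, smul_smul, inv_mul_cancel₀ hsq.ne',
      one_smul]

/-! #### (S6b, step 2) transport of classical solutions along the discrete part of the ray; pressure patching -/

section Transport

variable {E : Type*} [NormedAddCommGroup E] [InnerProductSpace ℝ E] [FiniteDimensional ℝ E]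

/-- Private copy of the tree's `IsClassicalNSSolutionOn.congr_velocity`. -/
theorem sc_congr_velocity {S : Set ℝ} {ν : ℝ}
    {f u v : ℝ → E → E} {p : ℝ → E → ℝ} (h : IsClassicalNSSolutionOn S ν f u p)
    (huv : ∀ t ∈ S, v t = u t) :
    IsClassicalNSSolutionOn S ν f v p where
  smooth_velocity :=
    h.smooth_velocity.congr fun z hz => by
      change v z.1 z.2 = u z.1 z.2
      rw [huv z.1 (mem_prod.1 hz).1]
  smooth_pressure := h.smooth_pressure
  momentum t ht x := by
    have h1 : timeDerivWithin S v t x = timeDerivWithin S u t x := by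
      simp only [timeDerivWithin]
      exact derivWithin_congr (fun s hs => by rw [huv s hs]) (by rw [huv t ht])
    rw [h1, huv t ht]
    exact h.momentum t ht x
  divFree t ht := by
    rw [huv t ht]
    exact h.divFree t ht

omit [FiniteDimensional ℝ E] in
/-- The forward form of rotated discrete self-similarity: `w = nsRescale c (R⁻¹ w R)`. -/
theorem nsRescale_conj_eq_of_isRotatedDSS {c : ℝ} {R : E ≃ₗᵢ[ℝ] E} {w : ℝ → E → E}
    (h : IsRotatedDSS c R w) : FluidPDE.nsRescale c (fun t x => R.symm (w t (R x))) = w := by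
  funext t x
  rw [nsRescale_apply, LinearIsometryEquiv.map_smul]
  exact h t x

/-- One step forward: a classical solution on `(a, b)` whose velocity is rotated-DSS with factor `2`
is a classical solution on `(a/4, b/4)` (rotate by `R⁻¹`, rescale by `2`). -/
theorem classical_piece_succ {w : ℝ → E → E} {R : E ≃ₗᵢ[ℝ] E} (hdss : IsRotatedDSS 2 R w)
    {a b : ℝ} {q : ℝ → E → ℝ} (hq : IsClassicalNSSolutionOn (Ioo a b) 1 0 w q) :
    ∃ q' : ℝ → E → ℝ, IsClassicalNSSolutionOn (Ioo (a / 4) (b / 4)) 1 0 w q' := by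
  have h1 := hq.conj_linearIsometryEquiv (R := R.symm) (uniqueDiffOn_Ioo _ _)
  have h2 := IsClassicalNSSolutionOn.nsRescale_holds h1 (show (0 : ℝ) < 2 by norm_num)
  have hf : nsRescaleForce 2 (fun t x => R.symm ((0 : ℝ → E → E) t (R.symm.symm x))) = 0 := by
    funext t x; simp [nsRescaleForce_apply]
  have hS : ((fun t => (2 : ℝ) ^ 2 * t) ⁻¹' Ioo a b) = Ioo (a / 4) (b / 4) := by
    ext t
    simp only [mem_preimage, mem_Ioo]
    constructor
    · rintro ⟨h1, h2⟩; constructor <;> linarith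
    · rintro ⟨h1, h2⟩; constructor <;> linarith
  have hv : FluidPDE.nsRescale 2 (fun t x => R.symm (w t (R.symm.symm x))) = w := by
    simp only [LinearIsometryEquiv.symm_symm]
    exact nsRescale_conj_eq_of_isRotatedDSS hdss
  rw [hf, hS, hv] at h2
  exact ⟨_, h2⟩

/-- All pieces `(−4/4^k, −1/(4·4^k))`, by induction. -/
theorem classical_pieces {w : ℝ → E → E} {R : E ≃ₗᵢ[ℝ] E} (hdss : IsRotatedDSS 2 R w)
    {q₀ : ℝ → E → ℝ} (h0 : IsClassicalNSSolutionOn (Ioo (-4) (-(1 / 4 : ℝ))) 1 0 w q₀) :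
    ∀ k : ℕ, ∃ q : ℝ → E → ℝ,
      IsClassicalNSSolutionOn (Ioo (-4 / 4 ^ k) (-(1 / 4 : ℝ) / 4 ^ k)) 1 0 w q := by
  intro k
  induction k with
  | zero => exact ⟨q₀, by simpa using h0⟩
  | succ k ih =>
      obtain ⟨q, hq⟩ := ih
      obtain ⟨q', hq'⟩ := classical_piece_succ hdss hq
      have ha : -4 / 4 ^ k / 4 = -4 / (4 : ℝ) ^ (k + 1) := by rw [pow_succ]; ring
      have hb : -(1 / 4 : ℝ) / 4 ^ k / 4 = -(1 / 4 : ℝ) / 4 ^ (k + 1) := by rw [pow_succ]; ring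
      rw [ha, hb] at hq'
      exact ⟨q', hq'⟩

/-- **One pressure on `(A, B)` from pressures on a covering family of open intervals** (the tree's
`IsClassicalNSSolutionOn.exists_pressure_Iio_of_Ioo` with general right endpoints). -/
theorem exists_pressure_Ioo_of_Ioo {ν : ℝ} {f v : ℝ → E → E}
    {a b : ℕ → ℝ} {q : ℕ → ℝ → E → ℝ} {A B : ℝ}
    (hsol : ∀ k, IsClassicalNSSolutionOn (Ioo (a k) (b k)) ν f v (q k))
    (hsub : ∀ k, Ioo (a k) (b k) ⊆ Ioo A B)
    (hexh : ∀ t ∈ Ioo A B, ∃ k, t ∈ Ioo (a k) (b k)) :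
    ∃ P : ℝ → E → ℝ, IsClassicalNSSolutionOn (Ioo A B) ν f v P := by
  choose! K hK using hexh
  have hagree : ∀ (j k : ℕ) (t : ℝ), t ∈ Ioo (a j) (b j) → t ∈ Ioo (a k) (b k) → ∀ x : E,
      q j t x - q j t 0 = q k t x - q k t 0 :=
    fun j k t hj hk x => (hsol j).pressure_sub_apply_zero_eq_of_eventuallyEq (hsol k)
      (Ioo_mem_nhds hj.1 hj.2) (Ioo_mem_nhds hk.1 hk.2) (Eventually.of_forall fun _ => rfl) x
  have hset : ∀ k : ℕ,
      (Ioo A B ×ˢ (univ : Set E)) ∩ Ioo (a k) (b k) ×ˢ univ = Ioo (a k) (b k) ×ˢ univ := by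
    intro k
    rw [prod_inter_prod, inter_eq_right.2 (hsub k), inter_self]
  refine ⟨fun t x => q (K t) t x - q (K t) t 0, ?_, ?_, ?_, ?_⟩
  · refine contDiffOn_of_locally_contDiffOn fun z hz => ?_
    obtain ⟨t, x⟩ := z
    have ht : t ∈ Ioo A B := hz.1
    refine ⟨Ioo (a (K t)) (b (K t)) ×ˢ univ, isOpen_Ioo.prod isOpen_univ, ⟨hK t ht, mem_univ _⟩, ?_⟩
    rw [hset]
    exact (hsol (K t)).smooth_velocity
  · refine contDiffOn_of_locally_contDiffOn fun z hz => ?_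
    obtain ⟨t, x⟩ := z
    have ht : t ∈ Ioo A B := hz.1
    refine ⟨Ioo (a (K t)) (b (K t)) ×ˢ univ, isOpen_Ioo.prod isOpen_univ, ⟨hK t ht, mem_univ _⟩, ?_⟩
    rw [hset]
    refine (hsol (K t)).smooth_pressure.sub_apply_zero.congr fun z hz => ?_
    obtain ⟨τ, y⟩ := z
    have hτ : τ ∈ Ioo (a (K t)) (b (K t)) := hz.1
    simp only [uncurry_apply_pair]
    exact hagree (K τ) (K t) τ (hK τ (hsub _ hτ)) hτ y
  · intro t ht x
    have hD : timeDerivWithin (Ioo A B) v t x = timeDerivWithin (Ioo (a (K t)) (b (K t))) v t x := by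
      simp only [timeDerivWithin_apply]
      rw [derivWithin_of_mem_nhds (Ioo_mem_nhds ht.1 ht.2),
        derivWithin_of_mem_nhds (Ioo_mem_nhds (hK t ht).1 (hK t ht).2)]
    rw [hD, gradient_sub_const]
    exact (hsol (K t)).momentum t (hK t ht) x
  · intro t ht
    exact (hsol (K t)).divFree t (hK t ht)

end Transport

/-- The pieces `(−4/4^k, −1/(4·4^k))` cover `(−4, 0)`. -/
theorem exists_piece {t : ℝ} (ht : t ∈ Ioo (-4 : ℝ) 0) :
    ∃ k : ℕ, t ∈ Ioo (-4 / 4 ^ k) (-(1 / 4 : ℝ) / 4 ^ k) := by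
  obtain ⟨h4, h0⟩ := ht
  have hs : 0 < -t := by linarith
  rcases lt_or_ge t (-1) with h1 | h1
  · exact ⟨0, by simp only [pow_zero, div_one]; constructor <;> linarith⟩
  · have hinv : (1 : ℝ) ≤ (-t)⁻¹ := (one_le_inv₀ hs).2 (by linarith)
    obtain ⟨n, hle, hlt⟩ := exists_nat_pow_near hinv (show (1 : ℝ) < 4 by norm_num)
    have h4n : (0 : ℝ) < 4 ^ n := by positivity
    refine ⟨n, ?_, ?_⟩
    · rw [div_lt_iff₀ h4n]
      have : (4 : ℝ) ^ n * (-t) ≤ 1 := by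
        have := mul_le_mul_of_nonneg_right hle hs.le
        rwa [inv_mul_cancel₀ hs.ne'] at this
      nlinarith
    · rw [lt_div_iff₀ h4n]
      have : 1 < (4 : ℝ) ^ (n + 1) * (-t) := by
        have := mul_lt_mul_of_pos_right hlt hs
        rwa [inv_mul_cancel₀ hs.ne'] at this
      rw [pow_succ] at this
      nlinarith

/-- (S6b♯, v7) `SpiralRayExtension` with the SPEED PINNED: the RSS extension of a limit field invariant under the
ray `{(e^σ, R_{βσ})}` has angular speed exactly `β/2` (this is what the v5 proof constructs; v7 records it in the
statement, because the speed-by-speed equivalence below needs to know WHICH speed the limit soliton has). -/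
def SpiralRayExtensionAt (C₀ : ℝ) : Prop :=
  ∀ (v : ℝ → ℝ³ → ℝ³) (p : ℝ → ℝ³ → ℝ) (β : ℝ),
    IsClassicalNSSolutionOn (Ioo (-4) (-(1 / 4 : ℝ))) 1 0 v p →
    (∀ t ≤ -(1 / 4 : ℝ), ∀ x : ℝ³, ‖v t x‖ ≤ C₀ / (‖x‖ + √(-t))) →
    (∀ σ : ℝ, 0 ≤ σ → InvPair v (Real.exp σ) (β * σ)) →
    ∃ (u : ℝ → ℝ³ → ℝ³) (P : ℝ → ℝ³ → ℝ),
      IsClassicalNSSolutionOn (Ico (-1) 0) 1 0 u P ∧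
      (∀ t ∈ Ico (-1 : ℝ) 0, ∀ x : ℝ³, ‖u t x‖ ≤ C₀ / (‖x‖ + Real.sqrt (-t))) ∧
      ContDiff ℝ 2 (v (-1)) ∧
      (∀ t ∈ Ico (-1 : ℝ) 0, ∀ x : ℝ³, u t x = pvAnsatz (β / 2) (fun y _ => v (-1) y) t x)

/-- **PROVED (v5; speed recorded v7).** Forward RSS extension along the spiral ray, speed `β/2`. -/
theorem spiralRayExtensionAt_holds : ∀ C₀ : ℝ, 0 < C₀ → SpiralRayExtensionAt C₀ := by
  intro C₀ hC₀ v p β hcl henv hray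
  have hslice := slice_formula hray
  -- the RSS field `w = pvAnsatz (β/2) v(−1)` is `v` on the window, hence classical there
  have h0 : IsClassicalNSSolutionOn (Ioo (-4) (-(1 / 4 : ℝ))) 1 0
      (pvAnsatz (β / 2) (fun y _ => v (-1) y)) p :=
    sc_congr_velocity hcl fun t ht => funext fun x => (hslice t ht.2.le x).symm
  -- it is rotated-DSS with factor `2`
  have hdss : IsRotatedDSS 2 (rotZLIE (-(β / 2 * (2 * Real.log 2))))
      (pvAnsatz (β / 2) (fun y _ => v (-1) y)) :=
    isRotatedDSS_pvAnsatz (by norm_num) fun y s => rfl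
  choose q hq using classical_pieces hdss h0
  have hsub : ∀ k : ℕ, Ioo (-4 / 4 ^ k) (-(1 / 4 : ℝ) / 4 ^ k) ⊆ Ioo (-4 : ℝ) 0 := by
    intro k
    have h4k : (1 : ℝ) ≤ 4 ^ k := one_le_pow₀ (by norm_num)
    have h4k' : (0 : ℝ) < 4 ^ k := by positivity
    refine Ioo_subset_Ioo ?_ ?_
    · rw [le_div_iff₀ h4k']; nlinarith
    · exact div_nonpos_of_nonpos_of_nonneg (by norm_num) h4k'.le
  obtain ⟨P, hP⟩ := exists_pressure_Ioo_of_Ioo (a := fun k => -4 / 4 ^ k)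
    (b := fun k => -(1 / 4 : ℝ) / 4 ^ k) hq hsub fun t ht => exists_piece ht
  have hU : ∀ y : ℝ³, ‖v (-1) y‖ ≤ C₀ / (‖y‖ + 1) := fun y => by
    have := henv (-1) (by norm_num) y
    simpa using this
  refine ⟨pvAnsatz (β / 2) (fun y _ => v (-1) y), P,
    hP.mono (fun t ht => ⟨by linarith [ht.1], ht.2⟩) (uniqueDiffOn_Ico _ _),
    fun t ht x => norm_pvAnsatz_le_of_profile hU ht.2 x, ?_, fun t ht x => rfl⟩
  exact (hcl.contDiff_velocity (by norm_num : (-1 : ℝ) ∈ Ioo (-4) (-(1 / 4 : ℝ)))).of_le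
    (by norm_cast)

/-- **(S6b) PROVED (v5; was stub `stub_spiralRayExtension`)** — in the registered form (speed existentially
quantified), from the pinned version `spiralRayExtensionAt_holds`. -/
theorem spiralRayExtension_holds : ∀ C₀ : ℝ, 0 < C₀ → SpiralRayExtension C₀ := by
  intro C₀ hC₀ v p β hcl henv hray
  obtain ⟨u, P, hu, henv', hC2, hans⟩ := spiralRayExtensionAt_holds C₀ hC₀ v p β hcl henv hray
  exact ⟨u, P, β / 2, hu, henv', hC2, hans⟩

/-! ### (S6a) PROVED (v6): the KNSS regularity window for spiral-invariant limit fields -/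

/-! #### (S6a) joint smoothness of the RSS ansatz field with a smooth time-independent profile -/

theorem sc_cd_scale : ContDiffOn ℝ ∞ (fun z : ℝ × ℝ³ => (Real.sqrt (-z.1))⁻¹) (Iio 0 ×ˢ univ) := by
  have hneg : ∀ z ∈ Iio (0 : ℝ) ×ˢ (univ : Set ℝ³), -z.1 ≠ 0 := fun z hz =>
    (neg_pos.2 (show z.1 < 0 from hz.1)).ne'
  have h1 : ContDiffOn ℝ ∞ (fun z : ℝ × ℝ³ => -z.1) (Iio 0 ×ˢ univ) := contDiff_fst.neg.contDiffOn
  exact (h1.sqrt hneg).inv fun z hz => (Real.sqrt_pos.2 (neg_pos.2 (show z.1 < 0 from hz.1))).ne'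

theorem sc_cd_angle (α : ℝ) : ContDiffOn ℝ ∞ (fun z : ℝ × ℝ³ => α * -Real.log (-z.1)) (Iio 0 ×ˢ univ) := by
  have hneg : ∀ z ∈ Iio (0 : ℝ) ×ˢ (univ : Set ℝ³), -z.1 ≠ 0 := fun z hz =>
    (neg_pos.2 (show z.1 < 0 from hz.1)).ne'
  have h1 : ContDiffOn ℝ ∞ (fun z : ℝ × ℝ³ => -z.1) (Iio 0 ×ˢ univ) := contDiff_fst.neg.contDiffOn
  exact contDiffOn_const.mul (h1.log hneg).neg

theorem sc_cd_inner (α : ℝ) : ContDiffOn ℝ ∞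
      (fun z : ℝ × ℝ³ => rotZ (-(α * -Real.log (-z.1))) ((Real.sqrt (-z.1))⁻¹ • z.2))
      (Iio 0 ×ˢ univ) := by
  have h := (contDiff_rotZ_uncurry (n := ∞)).comp_contDiffOn
    (((sc_cd_angle α).neg).prodMk (sc_cd_scale.smul contDiffOn_snd))
  simpa only [Function.comp_def, Pi.smul_apply', Pi.smul_apply, id_eq] using h

theorem sc_cd_outer (α : ℝ) {U₀ : ℝ³ → ℝ³} (hU : ContDiff ℝ ∞ U₀) : ContDiffOn ℝ ∞ (fun z : ℝ × ℝ³ =>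
      rotZ (α * -Real.log (-z.1)) (U₀ (rotZ (-(α * -Real.log (-z.1))) ((Real.sqrt (-z.1))⁻¹ • z.2))))
      (Iio 0 ×ˢ univ) := by
  have h3 := hU.comp_contDiffOn (sc_cd_inner α)
  have h := (contDiff_rotZ_uncurry (n := ∞)).comp_contDiffOn ((sc_cd_angle α).prodMk h3)
  simpa only [Function.comp_def, Pi.smul_apply', Pi.smul_apply, id_eq] using h

theorem sc_cd_field (α : ℝ) {U₀ : ℝ³ → ℝ³} (hU : ContDiff ℝ ∞ U₀) :
    ContDiffOn ℝ ∞ (fun z : ℝ × ℝ³ => (Real.sqrt (-z.1))⁻¹ •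
      rotZ (α * -Real.log (-z.1)) (U₀ (rotZ (-(α * -Real.log (-z.1))) ((Real.sqrt (-z.1))⁻¹ • z.2))))
      (Iio 0 ×ˢ univ) :=
  sc_cd_scale.smul (sc_cd_outer α hU)

theorem contDiffOn_uncurry_pvAnsatz_const (α : ℝ) {U₀ : ℝ³ → ℝ³} (hU : ContDiff ℝ ∞ U₀) :
    ContDiffOn ℝ ∞ (uncurry (pvAnsatz α (fun y _ => U₀ y))) (Iio 0 ×ˢ univ) := by
  refine (sc_cd_field α hU).congr ?_
  rintro ⟨t, x⟩ -
  simp only [Function.uncurry_apply_pair, pvAnsatz]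

theorem contDiff_rotZ_const (θ : ℝ) : ContDiff ℝ ∞ (fun y : ℝ³ => rotZ θ y) := by
  have h := (contDiff_rotZ_uncurry (n := ∞)).comp
    ((contDiff_const (c := θ)).prodMk (contDiff_id (E := ℝ³) (𝕜 := ℝ)))
  simpa only [Function.comp_def, Pi.smul_apply', Pi.smul_apply, id_eq] using h


/-- **(S6a) PROVED (v6; was stub `stub_spiralLimitRegular`).**  The rotated copy of Steps 1–4 of the tree's
`ChaeWolf.limit_eq_zero`: KNSS window ⇒ a smooth slice `v t₁` (`t₁ < −1/4`); the spiral slice relation read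
backwards ⇒ `v(−1)` smooth ⇒ `v = pvAnsatz (β/2) v(−1)` jointly smooth on `t < 0`; weakly div-free + smooth ⇒
div-free; pressure from the weak momentum identity; time-translation back to `(−4, −1/4)`. -/
theorem spiralLimitRegular_holds : ∀ C₀ : ℝ, 0 < C₀ → SpiralLimitRegular C₀ := by
  intro C₀ hC₀ v β hLF hray
  obtain ⟨hvc, hvI, hweak⟩ := hLF
  have hslice := slice_formula hray
  have hvb : ∀ t ≤ -(1 / 4 : ℝ), ∀ x, ‖v t x‖ ≤ 2 * C₀ := by
    intro t ht x
    refine (hvI t ht x).trans ?_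
    have h12 : (1 / 2 : ℝ) ≤ √(-t) := (Real.le_sqrt' (by norm_num)).2 (by nlinarith)
    have hden : (1 / 2 : ℝ) ≤ ‖x‖ + √(-t) := by linarith [norm_nonneg x]
    calc C₀ / (‖x‖ + √(-t)) ≤ C₀ / (1 / 2) :=
          div_le_div_of_nonneg_left hC₀.le (by norm_num) hden
      _ = 2 * C₀ := by ring
  have hvslice : ∀ t, Continuous (v t) := fun t =>
    hvc.comp (continuous_const.prodMk continuous_id)
  -- Step 1 (verbatim from `ChaeWolf.limit_eq_zero`): a smooth slice `v t₁`, `t₁ < -1/4`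
  obtain ⟨t₁, ht₁, hsm₁⟩ : ∃ t₁ < -(1 / 4 : ℝ), ContDiff ℝ ∞ (v t₁) := by
    obtain ⟨Cw, Lw, N, hwin⟩ :=
      KNSS2009_regularity_boundedWeak_window_holds (2 * C₀) 2 (by norm_num)
    have hw2 : IsBoundedWeakNSSolutionOn (Ioo 0 2) isOpen_Ioo 1
        (fun τ => v (τ + -2 - 1 / 4)) :=
      (hweak.mono (J := Ioo (-2) 0) isOpen_Ioo Ioo_subset_Iio_self).comp_add_right (-2)
        (J := Ioo 0 2) isOpen_Ioo fun τ => by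
          simp only [mem_Ioo]
          constructor <;> intro h <;> constructor <;> linarith [h.1, h.2]
    have hM : ∀ τ ∈ Ioo (0 : ℝ) 2, ∀ x, ‖v (τ + -2 - 1 / 4) x‖ ≤ 2 * C₀ := fun τ hτ x =>
      hvb _ (by linarith [hτ.2]) x
    obtain ⟨U, b, -, -, -, hae, hUs, -⟩ := hwin hw2 hM
    have hne : (ae ((volume : Measure ℝ).restrict (Ioo (0 : ℝ) 2))).NeBot := by
      rw [ae_neBot, Ne, Measure.restrict_eq_zero, Real.volume_Ioo]
      norm_num
    obtain ⟨τ₁, hτ₁, hτ₁m⟩ := (hae.and (ae_restrict_mem measurableSet_Ioo)).exists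
    refine ⟨τ₁ + -2 - 1 / 4, by linarith [hτ₁m.2], ?_⟩
    have hc2 : Continuous fun x => U τ₁ x + b τ₁ :=
      (hUs τ₁ hτ₁m).continuous.add continuous_const
    have heq : v (τ₁ + -2 - 1 / 4) = fun x => U τ₁ x + b τ₁ :=
      (Continuous.ae_eq_iff_eq volume (hvslice _) hc2).1 hτ₁
    rw [heq]
    exact (hUs τ₁ hτ₁m).add contDiff_const
  -- Step 2: the profile `v(-1)` is smooth, by the spiral slice relation read backwards
  have ht₁0 : t₁ < 0 := by linarith
  obtain ⟨r, hr⟩ : ∃ r : ℝ, r = Real.sqrt (-t₁) := ⟨_, rfl⟩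
  obtain ⟨θ₁, hθ⟩ : ∃ θ : ℝ, θ = β / 2 * -Real.log (-t₁) := ⟨_, rfl⟩
  have hrpos : 0 < r := by rw [hr]; exact Real.sqrt_pos.2 (by linarith)
  have hρ : ∀ y, v (-1) y = r • rotZ (-θ₁) (v t₁ (r • rotZ θ₁ y)) := by
    intro y
    have h := hslice t₁ ht₁.le (r • rotZ θ₁ y)
    simp only [pvAnsatz] at h
    rw [← hr, ← hθ, smul_smul, inv_mul_cancel₀ hrpos.ne', one_smul, rotZ_neg_rotZ] at h
    rw [h, rotZ_smul, rotZ_neg_rotZ, smul_smul, mul_inv_cancel₀ hrpos.ne', one_smul]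
  have hrot : ∀ θ : ℝ, ContDiff ℝ ∞ (fun y : ℝ³ => rotZ θ y) := contDiff_rotZ_const
  have hU₀s : ContDiff ℝ ∞ (v (-1)) := by
    rw [show v (-1) = fun y => r • rotZ (-θ₁) (v t₁ (r • rotZ θ₁ y)) from funext hρ]
    exact ((hrot (-θ₁)).comp (hsm₁.comp ((hrot θ₁).const_smul r))).const_smul r
  -- Step 3: the window `(0, 15/4)` of `W τ = v(τ − 4) = pvAnsatz (β/2) v(−1) (τ − 4)`
  set W : ℝ → ℝ³ → ℝ³ := fun τ => v (τ + -(15 / 4) - 1 / 4) with hW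
  have hWeq : ∀ τ ≤ (15 / 4 : ℝ), ∀ x,
      W τ x = pvAnsatz (β / 2) (fun y _ => v (-1) y) (τ + -(15 / 4) - 1 / 4) x :=
    fun τ hτ x => hslice _ (by linarith) x
  have hWsm : IsSmoothSpaceTimeOn (Ioo 0 (15 / 4)) W := by
    have h1 := contDiffOn_uncurry_pvAnsatz_const (β / 2) hU₀s
    have hφ : ContDiff ℝ ∞ (fun z : ℝ × ℝ³ => (z.1 + -(15 / 4) - 1 / 4, z.2)) :=
      ((contDiff_fst.add contDiff_const).sub contDiff_const).prodMk contDiff_snd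
    have hmaps : MapsTo (fun z : ℝ × ℝ³ => (z.1 + -(15 / 4) - 1 / 4, z.2))
        (Ioo 0 (15 / 4) ×ˢ univ) (Iio 0 ×ˢ univ) := fun z hz =>
      ⟨by simp only [mem_Iio]; linarith [(mem_prod.1 hz).1.2], mem_univ _⟩
    refine (h1.comp hφ.contDiffOn hmaps).congr ?_
    rintro ⟨τ, x⟩ hz
    have hτ : τ < 15 / 4 := (mem_prod.1 hz).1.2
    simp only [comp_apply, Function.uncurry_apply_pair]
    exact hWeq τ hτ.le x
  have hWweak : IsBoundedWeakNSSolutionOn (Ioo 0 (15 / 4)) isOpen_Ioo 1 W :=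
    (hweak.mono (J := Ioo (-(15 / 4)) 0) isOpen_Ioo Ioo_subset_Iio_self).comp_add_right
      (-(15 / 4)) (J := Ioo 0 (15 / 4)) isOpen_Ioo fun τ => by
        simp only [mem_Ioo]
        constructor <;> intro h <;> constructor <;> linarith [h.1, h.2]
  have hWdiv : ∀ τ ∈ Ioo (0 : ℝ) (15 / 4), VectorCalculus.IsDivFree (W τ) := fun τ hτ =>
    isDivFree_of_ae_isWeaklyDivFree_of_smooth hWsm hWweak.ae_isWeaklyDivFree hτ
  -- Step 4: the pressure
  have horth := fun {τ : ℝ} (hτ : τ ∈ Ioo (0 : ℝ) (15 / 4)) {φ : ℝ³ → ℝ³}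
      (hφ : FunctionSpaces.IsTestFunctionOn (⊤ : TopologicalSpace.Opens ℝ³) φ)
      (hφd : VectorCalculus.IsDivFree φ) =>
    integral_inner_momentum_eq_zero_of_slab_weak hWsm hWdiv hWweak.2.2.2 hτ hφ hφd
  have hf0 : IsSmoothSpaceTimeOn (Ioo 0 (15 / 4)) (0 : ℝ → ℝ³ → ℝ³) := contDiffOn_const
  obtain ⟨P, hcl⟩ := exists_isClassicalNSSolutionOn_of_forall_integral_inner_eq_zero isOpen_Ioo
    hWsm hf0 hWdiv (fun τ hτ φ hφ hφd => horth hτ hφ hφd)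
  -- Step 5: translate back to the window `(−4, −1/4)`
  have h2 := hcl.comp_add_right 4
  have hS : ((· + (4 : ℝ)) ⁻¹' Ioo (0 : ℝ) (15 / 4)) = Ioo (-4) (-(1 / 4 : ℝ)) := by
    ext t
    simp only [mem_preimage, mem_Ioo]
    constructor
    · rintro ⟨h1, h2⟩; constructor <;> linarith
    · rintro ⟨h1, h2⟩; constructor <;> linarith
  rw [hS] at h2
  refine ⟨fun t => P (t + 4), sc_congr_velocity (h2.congr_force (g := 0) fun t ht x => by simp only [Pi.zero_apply])
    fun t ht => ?_⟩
  funext x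
  show v t x = v (t + 4 + -(15 / 4) - 1 / 4) x
  rw [show t + 4 + -(15 / 4) - 1 / 4 = t by ring]

/-- **(S6) composition, PROVED:** the classical RSS Liouville statement (all speeds) kills spiral-invariant
limit fields, given the regularity window (S6a) and the forward extension (S6b). -/
theorem rssWeak_of_classical {C₀ : ℝ} (h6a : SpiralLimitRegular C₀) (h6b : SpiralRayExtension C₀)
    (hR : RssLiouvilleAll C₀) : RssLiouvilleWeak C₀ := by
  intro v β hLF hray
  obtain ⟨p, hcl⟩ := h6a v β hLF hray
  obtain ⟨u, P, α, hu, henv, hC2, hans⟩ := h6b v p β hcl hLF.2.1 hray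
  exact hR α u P (v (-1)) hu henv hC2 hans

/-! ### (S6) FROM THE TREE (v8, BC4 disclosure): `rssCompact_not_liouvilleAt_of_limit`

Self-reported dedup finding (v8): the content of S6a + S6b♯ — "a limit field invariant under a spiral ray is a
classical Pineau–Vicol-class rotated soliton of speed `β/2`, so RSS Liouville at that speed kills it" — has been in
the tree since 2026-08-16 as `Theorems.rssCompact_limit_classical` / `Theorems.rssCompact_not_liouvilleAt_of_limit`
(`Theorems/TypeICertificateLadderTargetRssCompactness{,Classical}.lean`, support of stmt-NavierStokesRegularity-1217,
line «killing-twisted-bernoulli-solitons», stub B5b), stated with `∀ μ ≥ 1` in place of the ray `σ = log μ ≥ 0`.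
From v8 on the compositions are routed THROUGH THE TREE (`rssWeak_of_rssCompact`, `rssWeakAt_of_rssCompact`);
the v5/v6 proofs `spiralRayExtension(At)_holds` / `spiralLimitRegular_holds` / `rssWeak_of_classical` stay in this
workfile as an independent re-proof on the window `(−4, −1/4)` but are NOT proposed for landing (duplicates). -/

/-- The ray hypothesis in the tree's `μ`-form: invariance under `(μ, R_{α₀ · 2 log μ})` for all `μ ≥ 1`. -/
theorem muForm_of_ray {v : ℝ → ℝ³ → ℝ³} {β : ℝ}
    (hray : ∀ σ : ℝ, 0 ≤ σ → InvPair v (Real.exp σ) (β * σ)) :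
    ∀ μ : ℝ, 1 ≤ μ → ∀ t ≤ -(1 / 4 : ℝ), ∀ x : ℝ³,
      v t x = μ • rotZ (β / 2 * (2 * Real.log μ)) (v (μ ^ 2 * t) (μ • rotZ (-(β / 2 * (2 * Real.log μ))) x)) := by
  intro μ hμ t ht x
  have h := hray (Real.log μ) (Real.log_nonneg hμ) t ht x
  rw [Real.exp_log (by linarith)] at h
  rwa [show β / 2 * (2 * Real.log μ) = β * Real.log μ by ring]

/-- **(S6) via the tree, AT ONE SPEED:** a limit OBJECT invariant under the ray `β` contradicts RSS Liouville at the
speed `β/2` (`Theorems.rssCompact_not_liouvilleAt_of_limit`, tree 2026-08-16). -/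
theorem false_of_ray_of_rssAt {C₀ : ℝ} {v : ℝ → ℝ³ → ℝ³} (hv : IsLimitObject C₀ v) {β : ℝ}
    (hray : ∀ σ : ℝ, 0 ≤ σ → InvPair v (Real.exp σ) (β * σ))
    (hR : ∀ (u : ℝ → ℝ³ → ℝ³) (p : ℝ → ℝ³ → ℝ) (U : ℝ³ → ℝ³),
      IsClassicalNSSolutionOn (Ico (-1) 0) 1 0 u p →
      (∀ t ∈ Ico (-1 : ℝ) 0, ∀ x : ℝ³, ‖u t x‖ ≤ C₀ / (‖x‖ + Real.sqrt (-t))) →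
      ContDiff ℝ 2 U →
      (∀ t ∈ Ico (-1 : ℝ) 0, ∀ x : ℝ³, u t x = pvAnsatz (β / 2) (fun y _ => U y) t x) →
      U = 0) : False :=
  Theorems.rssCompact_not_liouvilleAt_of_limit hv.1.1 hv.1.2.1 hv.1.2.2 (muForm_of_ray hray) hv.2 hR

/-- **(S6) via the tree:** `RssLiouvilleAll C₀ → RssLiouvilleWeak C₀` in three lines (v8 primary route). -/
theorem rssWeak_of_rssCompact {C₀ : ℝ} (hR : RssLiouvilleAll C₀) : RssLiouvilleWeak C₀ := by
  intro v β hLF hray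
  by_contra hne
  have hnt : ∃ x, v (-1) x ≠ 0 := by
    by_contra h
    push Not at h
    exact hne (funext h)
  exact false_of_ray_of_rssAt ⟨hLF, hnt⟩ hray (hR (β / 2))

/-! ### Proved: the self-similar branch dies (Tsai, via the tree) -/

/-- If the forward symmetry set of a limit object is ALL of `[0,∞) × ℝ`, the object is self-similar on
`t ≤ −1/4` and `ChaeWolf.limit_eq_zero` (Tsai 1998 through the tree) kills it. -/
theorem false_of_fullSym {C₀ : ℝ} {v : ℝ → ℝ³ → ℝ³} (hv : IsLimitObject C₀ v)
    (hA : ∀ σ θ : ℝ, 0 ≤ σ → (σ, θ) ∈ symSet v) : False := by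
  obtain ⟨⟨hc, hI, hw⟩, x, hx⟩ := hv
  have hss : ∀ μ : ℝ, 1 ≤ μ → ∀ t ≤ -(1 / 4 : ℝ), ∀ x, v t x = μ • v (μ ^ 2 * t) (μ • x) := by
    intro μ hμ t ht y
    have hμ0 : 0 < μ := by linarith
    have h := (hA (Real.log μ) 0 (Real.log_nonneg hμ)).2 t ht y
    simpa [Real.exp_log hμ0, rotZ_zero, neg_zero] using h
  have h0 := ChaeWolf.limit_eq_zero hc hI hw hss
  exact hx (by simpa using congrFun h0 x)

/-! ### Kernel-checked composition: the reduction -/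

/-- Squeeze: factors in `(1, 1 + 1/(n+1))` tend to `1`. -/
theorem tendsto_one_of_squeeze {c : ℕ → ℝ} (hc1 : ∀ n, 1 < c n)
    (hc2 : ∀ n, c n < 1 + 1 / ((n : ℝ) + 1)) : Tendsto c atTop (𝓝 1) := by
  have hup : Tendsto (fun n : ℕ => 1 + 1 / ((n : ℝ) + 1)) atTop (𝓝 1) := by
    have h : Tendsto (fun n : ℕ => 1 / ((n : ℝ) + 1)) atTop (𝓝 0) :=
      tendsto_one_div_add_atTop_nhds_zero_nat
    simpa using h.const_add 1
  exact tendsto_of_tendsto_of_tendsto_of_le_of_le tendsto_const_nhds hup (fun n => (hc1 n).le)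
    fun n => (hc2 n).le

/-- **The reduction from the obligations.**  Angle extraction + limit with symmetries + monoid structure +
the dichotomy + the weak RSS Liouville ⇒ near-one RDSS exclusion uniform in the speed. -/
theorem uniformNearOneRdss_of {C₀ : ℝ} (hC₀ : 0 < C₀) (h1 : AngleExtraction)
    (h2 : LimitWithSymmetries C₀) (h3 : SymSetMonoid) (h4 : ClosedMonoidDichotomy)
    (hR : RssLiouvilleWeak C₀) : UniformNearOneRdss C₀ := by
  by_contra H
  unfold UniformNearOneRdss at H
  push Not at H
  have hpos : ∀ n : ℕ, (1 : ℝ) < 1 + 1 / ((n : ℝ) + 1) := fun n => by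
    have : (0 : ℝ) < 1 / ((n : ℝ) + 1) := by positivity
    linarith
  choose α c u p U hc1 hc2 hsol hI hU2 hper hans y s _hs hne using fun n : ℕ => H _ (hpos n)
  have hclim : Tendsto c atTop (𝓝 1) := tendsto_one_of_squeeze hc1 hc2
  -- subsequence with convergent angles for every `μ_j`
  obtain ⟨φ, hφ, Θ, htune⟩ := h1 α c hc1 hclim
  have hclim' : Tendsto (c ∘ φ) atTop (𝓝 1) := hclim.comp hφ.tendsto_atTop
  -- the limit object with its symmetries
  obtain ⟨v, hv, hinv⟩ := h2 (α ∘ φ) (c ∘ φ) (fun n => u (φ n)) (fun n => p (φ n))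
    (fun n => U (φ n)) Θ (fun n => hc1 _) hclim' (fun n => hsol _) (fun n => hI _)
    (fun n => hper _) (fun n => hans _) (fun n => ⟨y _, s _, hne _⟩) htune
  obtain ⟨hcl, hzero, hadd, hneg, h2pi⟩ := h3 v hv.1.1
  -- small positive first coordinates: `(log μ_j, Θ j) ∈ symSet v`
  have hsmall : ∀ ε : ℝ, 0 < ε → ∃ g ∈ symSet v, 0 < g.1 ∧ g.1 < ε := by
    intro ε hε
    obtain ⟨j, hj⟩ := exists_nat_gt (1 / ε)
    have hjpos : (0 : ℝ) < (j : ℝ) + 1 := by positivity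
    set μ : ℝ := 1 + 1 / ((j : ℝ) + 1) with hμ
    have hμ1 : 1 < μ := hpos j
    have hμ0 : 0 < μ := zero_lt_one.trans hμ1
    refine ⟨(Real.log μ, Θ j), ⟨(Real.log_pos hμ1).le, ?_⟩, Real.log_pos hμ1, ?_⟩
    · show InvPair v (Real.exp (Real.log μ)) (Θ j)
      rw [Real.exp_log hμ0]
      exact hinv j
    · show Real.log μ < ε
      have hle : Real.log μ ≤ μ - 1 := Real.log_le_sub_one_of_pos hμ0
      have hlt : μ - 1 < ε := by
        rw [hμ, add_sub_cancel_left, div_lt_iff₀ hjpos]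
        have := (div_lt_iff₀ hε).1 hj
        nlinarith
      linarith
  rcases h4 (symSet v) hcl (fun g hg => hg.1) hzero hadd hneg h2pi hsmall with hA | ⟨β, hB⟩
  · exact false_of_fullSym hv hA
  · obtain ⟨hvf, x, hx⟩ := hv
    have h0 := hR v β hvf fun σ hσ => (hB σ hσ).2
    exact hx (by simpa using congrFun h0 x)

/-- **THE REDUCTION (rung theorem of the line).**  For every envelope constant `C₀ > 0`: Liouville for rotated
self-similar Type-I profiles at ALL speeds (Pineau–Vicol Conj. 1.1 at constant `C₀`) implies near-one RDSS
exclusion with a window UNIFORM in the speed — barrier lane (d) closed conditionally on an elliptic conjecture.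
(v6: SORRY-FREE — every obligation S1–S4, S6a, S6b is proved; no summit is proved.) -/
theorem uniformNearOneRdss_of_rss {C₀ : ℝ} (hC₀ : 0 < C₀) (hR : RssLiouvilleAll C₀) :
    UniformNearOneRdss C₀ :=
  uniformNearOneRdss_of hC₀ angleExtraction_holds (limitWithSymmetries_holds C₀ hC₀) symSetMonoid_holds
    closedMonoidDichotomy_holds (rssWeak_of_rssCompact hR)

/-- The same reduction with S6 discharged by THIS workfile's re-proof (v5/v6: `spiralLimitRegular_holds`,
`spiralRayExtension_holds`, `rssWeak_of_classical`) instead of the tree — kept to certify the re-proof composes. -/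
theorem uniformNearOneRdss_of_rss' {C₀ : ℝ} (hC₀ : 0 < C₀) (hR : RssLiouvilleAll C₀) :
    UniformNearOneRdss C₀ :=
  uniformNearOneRdss_of hC₀ angleExtraction_holds (limitWithSymmetries_holds C₀ hC₀) symSetMonoid_holds
    closedMonoidDichotomy_holds
    (rssWeak_of_classical (spiralLimitRegular_holds C₀ hC₀) (spiralRayExtension_holds C₀ hC₀) hR)

/-! ### Proved: the converse is trivial (solitons are breathers of every period) -/

/-- **Converse (kernel, no stubs).**  An RSS solution with speed `α` is `(α, c)`-RDSS for EVERY factor `c > 1`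
(profile constant in `s`), so near-one RDSS exclusion uniform in the speed gives back the RSS Liouville
statement at all speeds.  With `uniformNearOneRdss_of_rss`: near `λ = 1`, "no Type-I breathers" and
"no Type-I scaling solitons" are EQUIVALENT at fixed envelope constant — lane (d) of the near-one barrier
carries no difficulty beyond Pineau–Vicol Conjecture 1.1. -/
theorem rssLiouvilleAll_of_uniformNearOneRdss {C₀ : ℝ} (h : UniformNearOneRdss C₀) :
    RssLiouvilleAll C₀ := by
  obtain ⟨c₁, hc₁, H⟩ := h
  intro α u p U hsol hI hU2 hans
  -- the factor `c = (1 + c₁)/2 ∈ (1, c₁)`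
  have hc : (1 : ℝ) < (1 + c₁) / 2 := by linarith
  have hcc : (1 + c₁) / 2 < c₁ := by linarith
  have hlog : (0 : ℝ) ≤ 2 * Real.log ((1 + c₁) / 2) := by
    have := Real.log_pos hc
    positivity
  have hU2' : ContDiff ℝ 2 (fun q : ℝ³ × ℝ => (fun (y : ℝ³) (_ : ℝ) => U y) q.1 q.2) :=
    hU2.comp contDiff_fst
  have key := H α ((1 + c₁) / 2) u p (fun y _ => U y) hc hcc hsol hI hU2' (fun _ _ => rfl) hans
  funext y
  simpa using key y 0 ⟨le_rfl, hlog⟩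

/-- **v6 deliverable (kernel, sorry-free).**  Near `λ = 1`, at fixed envelope constant `C₀ > 0`, uniform-in-speed
RDSS exclusion and the all-speeds RSS Liouville statement (Pineau–Vicol Conj. 1.1 at constant `C₀`) are EQUIVALENT:
lane (d) of `NearOneDssTypeIExclusion` is IDENTIFIED with PV Conj. 1.1 — not closed.  No summit, and neither crux
23843 nor 24077, is proved. -/
theorem uniformNearOneRdss_iff_rss {C₀ : ℝ} (hC₀ : 0 < C₀) :
    UniformNearOneRdss C₀ ↔ RssLiouvilleAll C₀ :=
  ⟨rssLiouvilleAll_of_uniformNearOneRdss, uniformNearOneRdss_of_rss hC₀⟩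

/-! ### v7: THE EQUIVALENCE SPEED BY SPEED — openness of the RSS-Liouville speed set, and an UNCONDITIONAL
corollary (Pineau–Vicol Thm 1.4 ⇒ locally-uniform near-one RDSS exclusion near every speed of its Liouville region)

When the RDSS speeds `α_n` CONVERGE to `α₀`, no angle extraction is needed: the rotation angle of the
`μ_j`-rescaling is `α_n · 2 log(c_n^{k_n}) → 2α₀ log μ_j`, so the limit object's symmetry set contains the ALIGNED
points `(log μ_j, 2α₀ log μ_j)`, `j ∈ ℕ`; a closed additive monoid containing aligned points with abscissae
`→ 0⁺` contains the whole ray `{(σ, 2α₀σ) : σ ≥ 0}` (`ray_of_small_points`, from the landed `natMul_mem` +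
`floor_mul_tendsto`) — so the limit is a scaling SOLITON OF SPEED EXACTLY `α₀`, and RSS Liouville AT THAT ONE SPEED
kills it.  Consequences (all sorry-free): `nearOneRdssNear_iff_rssAt` (near-one RDSS exclusion locally uniformly
near `α₀` ⇔ RSS Liouville at `α₀`), `isOpen_setOf_rssLiouvilleAt` / `isCompact_badSpeeds` (the set of speeds
carrying a nontrivial rotated Type-I soliton with constant `C₀` is COMPACT, inside Pineau–Vicol's middle band),
`uniformNearOneRdss_iff_forall_near` (local-to-uniform), and the UNCONDITIONAL `nearOneRdssNear_of_pineauVicol`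
(tree `pineauVicol2026_rss_liouville_holds` = PV Thm 1.4 ⇒ near-one RDSS exclusion with a locally uniform window
near every speed `|α₀| < α₁ ∨ α₂ < |α₀|` — a Thm-1.7-type statement obtained WITHOUT re-running the energy method
with rotation).  The middle band `[α₁, α₂]` stays open: no summit, no crux closed. -/

/-- RSS Liouville AT ONE SPEED `α` (Pineau–Vicol Conj. 1.1 at envelope constant `C₀`, pointwise in the speed):
the inner statement of the tree's `pineauVicol2026_rss_liouville` at this `α`, restriction removed. -/
def RssLiouvilleAt (C₀ α : ℝ) : Prop :=
  ∀ (u : ℝ → ℝ³ → ℝ³) (p : ℝ → ℝ³ → ℝ) (U : ℝ³ → ℝ³),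
    IsClassicalNSSolutionOn (Ico (-1) 0) 1 0 u p →
    (∀ t ∈ Ico (-1 : ℝ) 0, ∀ x : ℝ³, ‖u t x‖ ≤ C₀ / (‖x‖ + Real.sqrt (-t))) →
    ContDiff ℝ 2 U →
    (∀ t ∈ Ico (-1 : ℝ) 0, ∀ x : ℝ³, u t x = pvAnsatz α (fun y _ => U y) t x) →
    U = 0

/-- `RssLiouvilleAll` is the conjunction over all speeds (definitional). -/
theorem rssLiouvilleAll_iff_forall_at {C₀ : ℝ} : RssLiouvilleAll C₀ ↔ ∀ α : ℝ, RssLiouvilleAt C₀ α :=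
  Iff.rfl

/-- NEAR-ONE RDSS EXCLUSION LOCALLY UNIFORMLY NEAR THE SPEED `α₀`: one window `(1, c₁)` serving every speed
`α` with `|α − α₀| ≤ δ`. -/
def NearOneRdssNear (C₀ α₀ : ℝ) : Prop :=
  ∃ c₁ : ℝ, 1 < c₁ ∧ ∃ δ : ℝ, 0 < δ ∧
    ∀ (α c : ℝ) (u : ℝ → ℝ³ → ℝ³) (p : ℝ → ℝ³ → ℝ) (U : ℝ³ → ℝ → ℝ³),
      |α - α₀| ≤ δ → 1 < c → c < c₁ →
      IsClassicalNSSolutionOn (Ico (-1) 0) 1 0 u p →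
      (∀ t ∈ Ico (-1 : ℝ) 0, ∀ x : ℝ³, ‖u t x‖ ≤ C₀ / (‖x‖ + Real.sqrt (-t))) →
      ContDiff ℝ 2 (fun q : ℝ³ × ℝ => U q.1 q.2) →
      (∀ (y : ℝ³) (s : ℝ), U y (s + 2 * Real.log c) = U y s) →
      (∀ t ∈ Ico (-1 : ℝ) 0, ∀ x : ℝ³, u t x = pvAnsatz α U t x) →
      ∀ (y : ℝ³), ∀ s ∈ Icc (0 : ℝ) (2 * Real.log c), U y s = 0

/-- ALIGNED POINTS FILL THE RAY: a closed additive monoid in `ℝ × ℝ` containing points `(ε_j, β ε_j)` with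
`ε_j → 0⁺` contains `(σ, βσ)` for every `σ ≥ 0` (landed `natMul_mem` + `floor_mul_tendsto`). -/
theorem ray_of_small_points {M : Set (ℝ × ℝ)} (hcl : IsClosed M) (h0 : ((0 : ℝ), (0 : ℝ)) ∈ M)
    (hadd : ∀ g ∈ M, ∀ h ∈ M, g + h ∈ M) {β : ℝ} {ε : ℕ → ℝ} (hpos : ∀ j, 0 < ε j)
    (hlim : Tendsto ε atTop (𝓝 0)) (hmem : ∀ j, (ε j, β * ε j) ∈ M) :
    ∀ σ : ℝ, 0 ≤ σ → (σ, β * σ) ∈ M := by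
  intro σ hσ
  have hseq : ∀ j, ((⌊σ / ε j⌋₊ : ℝ) * ε j, β * ((⌊σ / ε j⌋₊ : ℝ) * ε j)) ∈ M := by
    intro j
    have h := natMul_mem h0 hadd (hmem j) ⌊σ / ε j⌋₊
    have e : ((⌊σ / ε j⌋₊ : ℕ) : ℝ) • (ε j, β * ε j) =
        ((⌊σ / ε j⌋₊ : ℝ) * ε j, β * ((⌊σ / ε j⌋₊ : ℝ) * ε j)) :=
      Prod.ext (by simp [smul_eq_mul]) (by simp [smul_eq_mul]; ring)
    rwa [e] at h
  have hf := floor_mul_tendsto hσ hpos hlim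
  exact hcl.mem_of_tendsto (hf.prodMk_nhds (hf.const_mul β)) (Eventually.of_forall hseq)

/-- A limit object with ALIGNED symmetries `(μ_j, R_{β log μ_j})`, `μ_j = 1 + 1/(j+1)`, is invariant under the
whole spiral ray `{(e^σ, R_{βσ}) : σ ≥ 0}`. -/
theorem ray_of_aligned {C₀ : ℝ} {v : ℝ → ℝ³ → ℝ³} (hv : IsLimitObject C₀ v) {β : ℝ}
    (hinv : ∀ j : ℕ, InvPair v (1 + 1 / ((j : ℝ) + 1)) (β * Real.log (1 + 1 / ((j : ℝ) + 1)))) :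
    ∀ σ : ℝ, 0 ≤ σ → InvPair v (Real.exp σ) (β * σ) := by
  obtain ⟨hcl, hzero, hadd, -, -⟩ := symSetMonoid_holds v hv.1.1
  have hμ1 : ∀ j : ℕ, (1 : ℝ) < 1 + 1 / ((j : ℝ) + 1) := fun j => by
    have : (0 : ℝ) < 1 / ((j : ℝ) + 1) := by positivity
    linarith
  have hpos : ∀ j : ℕ, 0 < Real.log (1 + 1 / ((j : ℝ) + 1)) := fun j => Real.log_pos (hμ1 j)
  have hmem : ∀ j : ℕ,
      (Real.log (1 + 1 / ((j : ℝ) + 1)), β * Real.log (1 + 1 / ((j : ℝ) + 1))) ∈ symSet v := by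
    intro j
    refine ⟨(hpos j).le, ?_⟩
    show InvPair v (Real.exp (Real.log (1 + 1 / ((j : ℝ) + 1)))) (β * Real.log (1 + 1 / ((j : ℝ) + 1)))
    rw [Real.exp_log ((zero_lt_one.trans (hμ1 j)))]
    exact hinv j
  have hlim : Tendsto (fun j : ℕ => Real.log (1 + 1 / ((j : ℝ) + 1))) atTop (𝓝 0) := by
    have h1 : Tendsto (fun j : ℕ => 1 + 1 / ((j : ℝ) + 1)) atTop (𝓝 1) := by
      simpa using (tendsto_one_div_add_atTop_nhds_zero_nat).const_add (1 : ℝ)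
    simpa [Real.log_one, Function.comp_def] using ((Real.continuousAt_log one_ne_zero).tendsto.comp h1)
  intro σ hσ
  exact (ray_of_small_points hcl hzero hadd hpos hlim hmem σ hσ).2

/-- Speeds within `1/(n+1)` of `α₀` converge to `α₀`. -/
theorem tendsto_of_abs_sub_le {α : ℕ → ℝ} {α₀ : ℝ} (h : ∀ n : ℕ, |α n - α₀| ≤ 1 / ((n : ℝ) + 1)) :
    Tendsto α atTop (𝓝 α₀) := by
  rw [tendsto_iff_norm_sub_tendsto_zero]
  exact squeeze_zero (fun n => norm_nonneg _) (fun n => by simpa [Real.norm_eq_abs] using h n)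
    tendsto_one_div_add_atTop_nhds_zero_nat

/-- **FORWARD, SPEED BY SPEED — IN THE TREE** (BC4 self-disclosure no. 2, v9): this is, up to `|α − α₀| < δ`
versus `≤ δ`, EXACTLY `Theorems.rdssCompact_liouville_near` of `…TypeICertificateLadderTargetRdssLiouvilleNear`
(support of stmt-NavierStokesRegularity-1217, stub B5b, landed 2026-08-16; proof there: Chae–Wolf compactness on RDSS
sequences `α_n → α₀`, `c_n → 1` with full tuning `c_n^{k_n} → μ ∀ μ ≥ 1` and ALIGNED angles `→ 2α₀ log μ`, then
`rssCompact_not_liouvilleAt_of_limit`).  RSS Liouville at the single speed `α₀` implies near-one RDSS exclusion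
with one window serving all speeds near `α₀`.  v9 CITES the tree theorem; the line's own v7 derivation (aligned
countable tuning + `ray_of_aligned` in the symmetry monoid) is kept below as `nearOneRdssNear_of_rssAt'`. -/
theorem nearOneRdssNear_of_rssAt {C₀ α₀ : ℝ} (hC₀ : 0 < C₀) (hR : RssLiouvilleAt C₀ α₀) :
    NearOneRdssNear C₀ α₀ := by
  -- IN THE TREE since 2026-08-16 (BC4, v9): `Theorems.rdssCompact_liouville_near` — cited, not claimed.
  obtain ⟨δ, hδ, c₁, hc₁, H⟩ := Theorems.rdssCompact_liouville_near C₀ hC₀ α₀ hR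
  exact ⟨c₁, hc₁, δ / 2, by positivity, fun α c u p U hα hc hcc => H α c u p U (by linarith) hc hcc⟩

/-- The v7 derivation of the same forward step BY THE MONOID ROUTE (kept as a certified alternative; content = tree
`rdssCompact_liouville_near`): a bad sequence has `α_n → α₀`, `c_n ↓ 1`; the limit object (S2, with the ALIGNED
tuning `Θ_j = α₀ · 2 log μ_j`, no subsequence) is invariant under the aligned pairs, hence (`ray_of_aligned`) under
the ray `β = 2α₀`, hence (tree `rssCompact_limit_classical` / `rssCompact_not_liouvilleAt_of_limit`) is a classical
rotated soliton of speed `2α₀/2 = α₀` on `[−1,0)` — killed by the hypothesis. -/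
theorem nearOneRdssNear_of_rssAt' {C₀ α₀ : ℝ} (hC₀ : 0 < C₀) (hR : RssLiouvilleAt C₀ α₀) :
    NearOneRdssNear C₀ α₀ := by
  by_contra H
  unfold NearOneRdssNear at H
  push Not at H
  have hpos : ∀ n : ℕ, (1 : ℝ) < 1 + 1 / ((n : ℝ) + 1) := fun n => by
    have : (0 : ℝ) < 1 / ((n : ℝ) + 1) := by positivity
    linarith
  have hpos' : ∀ n : ℕ, (0 : ℝ) < 1 / ((n : ℝ) + 1) := fun n => by positivity
  choose α c u p U hα hc1 hc2 hsol hI _hU2 hper hans y s _hs hne using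
    fun n : ℕ => H _ (hpos n) _ (hpos' n)
  have hclim : Tendsto c atTop (𝓝 1) := tendsto_one_of_squeeze hc1 hc2
  have hαlim : Tendsto α atTop (𝓝 α₀) := tendsto_of_abs_sub_le hα
  -- ALIGNED tuning data for (S2): exponents from the tree, integer corrections `m = 0`
  have htune : ∀ j : ℕ, ∃ (k : ℕ → ℕ) (m : ℕ → ℤ),
      Tendsto (fun n => c n ^ k n) atTop (𝓝 (1 + 1 / ((j : ℝ) + 1))) ∧
      Tendsto (fun n => α n * (2 * Real.log (c n ^ k n)) - 2 * Real.pi * m n) atTop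
        (𝓝 (α₀ * (2 * Real.log (1 + 1 / ((j : ℝ) + 1))))) := by
    intro j
    have hk := tendsto_pow_natFloor_log hc1 hclim (hpos j).le
    refine ⟨_, fun _ => 0, hk, ?_⟩
    have hμ0 : (1 + 1 / ((j : ℝ) + 1)) ≠ 0 := (zero_lt_one.trans (hpos j)).ne'
    have hlog := ((Real.continuousAt_log hμ0).tendsto.comp hk)
    have h := hαlim.mul (hlog.const_mul 2)
    simpa [Function.comp_def] using h
  obtain ⟨v, hv, hinv⟩ := limitWithSymmetries_holds C₀ hC₀ α c u p U
    (fun j => α₀ * (2 * Real.log (1 + 1 / ((j : ℝ) + 1)))) hc1 hclim hsol hI hper hans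
    (fun n => ⟨y n, s n, hne n⟩) htune
  -- the aligned pairs fill the ray `β = 2α₀`
  have hinv' : ∀ j : ℕ, InvPair v (1 + 1 / ((j : ℝ) + 1)) (2 * α₀ * Real.log (1 + 1 / ((j : ℝ) + 1))) :=
    fun j => by
      have h := hinv j
      rwa [show α₀ * (2 * Real.log (1 + 1 / ((j : ℝ) + 1))) =
        2 * α₀ * Real.log (1 + 1 / ((j : ℝ) + 1)) by ring] at h
  have hray := ray_of_aligned hv hinv'
  -- the limit is a classical rotated soliton of speed `2α₀/2 = α₀` on `[−1,0)`: killed (S6 via the tree)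
  have hR' := hR
  rw [show α₀ = 2 * α₀ / 2 by ring] at hR'
  exact false_of_ray_of_rssAt hv hray hR'

/-- **CONVERSE, SPEED BY SPEED (trivial: solitons are breathers of every period).**  A window near `α₀` gives
RSS Liouville at EVERY speed of the window. -/
theorem rssAt_near_of_nearOneRdssNear {C₀ α₀ : ℝ} (h : NearOneRdssNear C₀ α₀) :
    ∃ δ : ℝ, 0 < δ ∧ ∀ α : ℝ, |α - α₀| ≤ δ → RssLiouvilleAt C₀ α := by
  obtain ⟨c₁, hc₁, δ, hδ, H⟩ := h
  refine ⟨δ, hδ, fun α hα u p U hsol hI hU2 hans => ?_⟩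
  have hc : (1 : ℝ) < (1 + c₁) / 2 := by linarith
  have hcc : (1 + c₁) / 2 < c₁ := by linarith
  have hlog : (0 : ℝ) ≤ 2 * Real.log ((1 + c₁) / 2) := by
    have := Real.log_pos hc
    positivity
  have hU2' : ContDiff ℝ 2 (fun q : ℝ³ × ℝ => (fun (y : ℝ³) (_ : ℝ) => U y) q.1 q.2) :=
    hU2.comp contDiff_fst
  have key := H α ((1 + c₁) / 2) u p (fun y _ => U y) hα hc hcc hsol hI hU2' (fun _ _ => rfl) hans
  funext y
  simpa using key y 0 ⟨le_rfl, hlog⟩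

/-- In particular RSS Liouville at `α₀` itself. -/
theorem rssAt_of_nearOneRdssNear {C₀ α₀ : ℝ} (h : NearOneRdssNear C₀ α₀) : RssLiouvilleAt C₀ α₀ := by
  obtain ⟨δ, hδ, H⟩ := rssAt_near_of_nearOneRdssNear h
  exact H α₀ (by simpa using hδ.le)

/-- **THE EQUIVALENCE SPEED BY SPEED (v7 kernel theorem).**  At fixed envelope constant `C₀ > 0` and for every
speed `α₀`: near-one RDSS exclusion locally uniformly near `α₀` ⇔ Liouville for rotated Type-I solitons of speed
`α₀`.  (v6's `uniformNearOneRdss_iff_rss` is the all-speeds version; this one localises the bad sets: the speeds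
carrying a Type-I breather of factor arbitrarily close to `1` nearby are EXACTLY the speeds carrying a soliton.) -/
theorem nearOneRdssNear_iff_rssAt {C₀ : ℝ} (hC₀ : 0 < C₀) (α₀ : ℝ) :
    NearOneRdssNear C₀ α₀ ↔ RssLiouvilleAt C₀ α₀ :=
  ⟨rssAt_of_nearOneRdssNear, nearOneRdssNear_of_rssAt hC₀⟩

/-- **OPENNESS — IN THE TREE** (`Theorems.rssCompact_isOpen_good`, 2026-08-16, Chae–Wolf compactness run on RSS
sequences `α_n → α₀`); v8 cites it.  The set of speeds at which RSS Liouville holds (constant `C₀`) is OPEN. -/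
theorem isOpen_setOf_rssLiouvilleAt {C₀ : ℝ} (hC₀ : 0 < C₀) : IsOpen {α : ℝ | RssLiouvilleAt C₀ α} :=
  -- IN THE TREE since 2026-08-16 (BC4, v8): `Theorems.rssCompact_isOpen_good` — cited, not claimed.
  Theorems.rssCompact_isOpen_good hC₀

/-- The same openness BY THE BREATHER ROUTE (v7's proof, kept as the RDSS-side derivation): Liouville at `α₀` ⇒ a
near-one RDSS window near `α₀` ⇒ Liouville at every speed of the window. -/
theorem isOpen_setOf_rssLiouvilleAt' {C₀ : ℝ} (hC₀ : 0 < C₀) : IsOpen {α : ℝ | RssLiouvilleAt C₀ α} := by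
  rw [Metric.isOpen_iff]
  intro α₀ hα₀
  obtain ⟨δ, hδ, H⟩ := rssAt_near_of_nearOneRdssNear (nearOneRdssNear_of_rssAt hC₀ hα₀)
  refine ⟨δ, hδ, fun α hα => H α ?_⟩
  have : dist α α₀ < δ := hα
  rw [Real.dist_eq] at this
  exact this.le

/-- **Packaging (v7/v8; both inclusions are one-liners over the tree's `rdssCompact_liouville_near` and the trivial
converse): the near-one-window speed set is OPEN and EQUALS the RSS-Liouville speed set.** -/
theorem setOf_nearOneRdssNear_eq {C₀ : ℝ} (hC₀ : 0 < C₀) :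
    {α₀ : ℝ | NearOneRdssNear C₀ α₀} = {α : ℝ | RssLiouvilleAt C₀ α} :=
  Set.ext fun α₀ => nearOneRdssNear_iff_rssAt hC₀ α₀

theorem isOpen_setOf_nearOneRdssNear {C₀ : ℝ} (hC₀ : 0 < C₀) : IsOpen {α₀ : ℝ | NearOneRdssNear C₀ α₀} := by
  rw [setOf_nearOneRdssNear_eq hC₀]
  exact isOpen_setOf_rssLiouvilleAt hC₀

/-- **COMPACTNESS OF THE BAD SPEEDS — IN THE TREE** (`Theorems.rssCompact_isCompact_bad`, stated with
`∃ … ∧ U ≠ 0`; this is the `¬ ∀` form, re-derived in ten lines; v8 cites it).  The set of speeds `α` carrying a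
nontrivial rotated Type-I soliton with constant `C₀` is COMPACT (closed by openness of its complement, bounded by
`pineauVicol2026_rss_liouville_holds`: it lies in `[−α₂, α₂]`). -/
theorem isCompact_badSpeeds {C₀ : ℝ} (hC₀ : 0 < C₀) : IsCompact {α : ℝ | ¬ RssLiouvilleAt C₀ α} := by
  obtain ⟨α₁, α₂, -, h2, H⟩ := pineauVicol2026_rss_liouville_holds C₀ hC₀
  have hcl : IsClosed {α : ℝ | ¬ RssLiouvilleAt C₀ α} := by
    have h := (isOpen_setOf_rssLiouvilleAt hC₀).isClosed_compl
    simpa [Set.compl_setOf] using h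
  refine (isCompact_Icc (a := -α₂) (b := α₂)).of_isClosed_subset hcl fun α hα => ?_
  by_contra hout
  refine hα fun u p U hsol hI hU2 hans => H α u p U hsol hI hU2 hans (Or.inr ?_)
  simp only [mem_Icc, not_and_or, not_le] at hout
  rcases hout with h | h
  · have : α < 0 := by linarith
    rw [abs_of_neg this]; linarith
  · exact lt_of_lt_of_le h (le_abs_self α)

/-- **LOCAL-TO-UNIFORM (v7) — the line's OWN statement after both disclosures.**  Windows near every speed ⇔ ONE
window for ALL speeds (unbounded).  `⇐` is trivial; `⇒` needs the all-speeds extraction of v6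
(`uniformNearOneRdss_of_rss`: S1 angle extraction mod 2π for ARBITRARY speed sequences, incl. `|α_n| → ∞`, + the
S3/S4 monoid dichotomy) — exactly the step the tree's `…RdssLiouvilleNear` records as NOT proved there («needs an
extraction along |α_n| → ∞ with arithmetic tuning of the angles»).  Note the honest limit: the extraction controls
the limit's symmetry RAY, not its speed, so this is local-to-uniform GIVEN all speeds, not PV Thm 1.7 (ii). -/
theorem uniformNearOneRdss_iff_forall_near {C₀ : ℝ} (hC₀ : 0 < C₀) :
    UniformNearOneRdss C₀ ↔ ∀ α₀ : ℝ, NearOneRdssNear C₀ α₀ := by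
  refine ⟨fun ⟨c₁, hc₁, H⟩ α₀ => ⟨c₁, hc₁, 1, one_pos, fun α c u p U _ => H α c u p U⟩, fun h => ?_⟩
  exact uniformNearOneRdss_of_rss hC₀ fun α => rssAt_of_nearOneRdssNear (h α)

/-- **UNCONDITIONAL COROLLARY — IN THE TREE** (BC4 self-disclosure no. 2, v9): up to `<`/`≤` this is EXACTLY
`Theorems.rdssCompact_liouville_near_of_extreme` (stmt-1217 support, 2026-08-16), including its remark «Thm-1.7-type
statement by compactness, not by the energy method; window depends on α₀, no uniformity as |α₀| → ∞».  From the
tree's Pineau–Vicol Thm 1.4 (`pineauVicol2026_rss_liouville_holds`): near every speed of its Liouville region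
`|α₀| < α₁ ∨ α₂ < |α₀|` there is a near-one RDSS exclusion window serving all nearby speeds.  (The middle band is
untouched.)  Cited, not claimed; kept for the packaging `uniformNearOneRdss_iff_forall_near`. -/
theorem nearOneRdssNear_of_pineauVicol {C₀ : ℝ} (hC₀ : 0 < C₀) :
    ∃ α₁ α₂ : ℝ, 0 < α₁ ∧ 0 < α₂ ∧
      ∀ α₀ : ℝ, (|α₀| < α₁ ∨ α₂ < |α₀|) → NearOneRdssNear C₀ α₀ := by
  obtain ⟨α₁, α₂, h1, h2, H⟩ := pineauVicol2026_rss_liouville_holds C₀ hC₀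
  exact ⟨α₁, α₂, h1, h2, fun α₀ hα₀ =>
    nearOneRdssNear_of_rssAt hC₀ fun u p U hsol hI hU2 hans => H α₀ u p U hsol hI hU2 hans hα₀⟩

end Summit.NavierStokesRegularity.NavierStokesRegularity.Cruxes.ScarEnvelopeTypeI.SpiralClosure

end
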